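import Literature.Probability.LatticeModels.PolymerGasGeometric
import Literature.MathematicalPhysics.QuantumFieldTheory.BalabanImbrieJaffe1984to88.BIJ88Sect5StatementsPart2

/-!
# `BalabanImbrieJaffe1984to88.BIJ88Ineq5113Covering` — T. Bałaban, J. Imbrie, A. Jaffe, *Effective action and cluster
properties of the abelian Higgs model*, Commun. Math. Phys. **114** (1988) 257–315 [BalabanImbrieJaffe1988]: Sect. 5.11
*Mayer Expansion I*, the "typical estimate" **(5.11.3)** p. 299 — the covering sum of the Mayer expansion MODELLED CONCRETELY
(polymers = connected unions of cubes, triplets `(j, x_j, X)`, coverings `⋃_α X_α = X`), the display REFUTED with the printed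
constants (one cube, one large-field point) and PROVED in the repaired form that the p. 299 proof sketch actually yields
(rate `c′ < c` in the exponential, a worst-case constant `κ e^{O(κ + θ/κ)}` per cube), along the printed sketch

HONEST FRAMING (cell `lit-balaban`, verbatim): statement-level skeleton of published theorems with citation tags; proofs where landed; nothing here is a claim about the Yang–Mills mass gap.

PDF held: `paper:balaban1988-cmp114-bij-abelian-higgs-effective-action` (journal page = PDF page + 256); p. 299 = PDF p. 43 read
from the OCR text (`lit read … --pages 43`, `~/.lit/texts/paper-balaban1988-cmp114-bij-abelian-higgs-effective-action/p0043.txt`)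
and against the typed row `BIJ88Sect5StatementsPart2.Ineq5111/Ineq5113` (r16, reviewed p240155).

CITATION HEADER (verbatim, p. 299 [PDF 43]).  *"5.11. Mayer Expansion I. In this section we expand irrelevant terms down from
the exponent. … We can only Mayer-expand small terms, therefore we parcel up W₄^{(k)}(X) into manageable chunks. It is a simple
matter to decompose W₄^{(k)}(X) as follows* `W₄^{(k)}(X) = Σ_{j<k} Σ_{x_j ∈ B_{k−j−1}(X)∩Λ₅^{(j)′}∩Λ₆^{(j+1)c}} W_{4,j}^{(k)}(x_j, X)
+ W_{4,k}^{(k)}(x_k, X).` *Here x_k is some distinguished point in X (for unity of notation) and*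
`|W_{4,j}^{(k)}(x_j, X)| ≤ e_j^{1−α} e^{−cr(e_k)|X|},  |W_{4,k}^{(k)}(x_k, X)| ≤ [e^β(L^kε/ε₀)]^{n̄+1} e^{−cr(e_k)|X|^−}.` (5.11.1)
*The Mayer expansion is the usual identity* `exp[−Σ W_{4,j}^{(k)}(x_j, X)] = Σ Π (e^{−W(x_j,X)} − 1).` (5.11.2) *Let S̄₄ be the set
of all triplets (j, x_j, X) that arise in the above decomposition of W₄^{(k)}(X), for any X. Then S₄ is summed over subsets of
S̄₄. Note that e^{−W_{4,j}^{(k)}(x_j,X)} − 1 satisfies the same bound as W_{4,j}^{(k)}(x_j, X). To see what kind of control we have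
over this expansion, let us do a typical estimate of the type we need:*
`|Σ_{S₄ = {(j_α, x_{j,α}, X_α)} : ⋃_α X_α = X} Π_α (e^{−W_{4,j}^{(k)}(x_{j,α}, X_α)} − 1)|
   ≤ exp(Σ_{j<k} e_j^{1−α} e^{−cr(e_k)} |B_{k−j−1}(X) ∩ Λ₅^{(j)′} ∩ Λ₆^{(j+1)c}|) [e^β(L^kε/ε₀)]^{(n̄+1)|X|}.` (5.11.3)
*We consider first sums over X_α such that x_{j,α} = x_j. A combinatoric factor c^{|X_α|} controls each sum over X_α, and can
be absorbed into the factors e^{−cr(e_k)|X_α|^−} in our bounds on e^{−W^{(k)}(x_j, X_α)} − 1. If there are n such sets, we use n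
factors of e_j^{1−α} e^{−cr(e_k)}, j < k. The resulting estimate has a factor Σ_{n=0}^∞ (e_j^{1−α} e^{−cr(e_k)})^n/n! ≤
exp(e_j^{1−α} e^{−c′r(e_k)}) at each x_j, j < k, or O(1), j = k. There remains a factor [e^β(L^kε/ε₀)]^{(n̄+1)|X|} from a
worst-case analysis of the unused small factors, and (5.11.3) follows."*  (p. 289: *"X's are arbitrary connected unions of
r(e_k)-cubes"*; p. 290: *"|X|^− = max{0, |X| − 1}"*.)

WHAT IS REPRODUCED (unit `lit-balaban-p25`, generation 3 of the Phase-2 proof seat p25; SKELETON row `C2.Eq5.11.3` of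
`HOME/lit-balaban-r16/ROWS-C2-part2.md`, typed as the abstract `Prop` leaf `BIJ88Sect5StatementsPart2.Ineq5113` with the
covering sum an abstract functional (ref-1 F6); HOME `run/shared/lean/pub/lit-balaban/lit-balaban-p25/`).
§1 THE MODEL of the left side of (5.11.3): cubes `V` with an adjacency `R`; polymers inside `X` = nonempty `R`-connected
`Y ⊆ X` (`polys`, the tree's `IsRConnected`); large-field points `lf j : Finset Pt` of level `j` with `home : Pt → V` the cube of a
point, so that `x_j ∈ B_{k−j−1}(Y) ∩ Λ₅^{(j)′} ∩ Λ₆^{(j+1)c}` is read as "`x_j ∈ lf j` and `home x_j ∈ Y`" (`pts`, `lfVol` — the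
READING of this file: the admissible points of a polymer are the level-`j` large-field points lying in it, so that
`|B_{k−j−1}(X) ∩ …|` on the right of (5.11.3) counts the points available to the polymers inside `X`); triplets `Trip` = `(j, x_j, Y)`
with `j < k` or the one distinguished `j = k` term per polymer (`tripJ`, `trips`); coverings `covers X` = sets `S₄` of triplets
with `⋃ X_α = X`; `mayerSum a X = Σ_{S₄ ∈ covers X} Π_{α ∈ S₄} a(α)`, activities `act W = e^{−W} − 1`; `cubeSys V` instantiates
r16's `PolymerSys` by `(Finset V, card)`, so that `Ineq5111`/`Ineq5113` of the typed row apply verbatim.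
§2–§5 THE p. 299 SKETCH MADE EXACT, PROVED (`abs_mayerSum_le`): for activities with `|a(j, x_j, Y)| ≤ ε_j θ^{|Y|}` (`j < k`),
`|a(k, x_k, Y)| ≤ κ θ^{|Y|^−}` (`bnd`; the shape of (5.11.1) with `ε_j ↤ e_j^{1−α}`, `θ ↤ e^{−cr(e_k)}`, `κ ↤ [e^β(L^kε/ε₀)]^{n̄+1}`),
`R` symmetric of degree `≤ Δ`, `0 < κ ≤ 1` and the smallness `2(Δ+1)²θ ≤ κ`:
`|mayerSum a X| ≤ exp((θ + θ/κ + 4(Δ+1)²(θ/κ)²) Σ_{j<k} ε_j lfVol j X) · (κ e^{κ + 4(Δ+1)²θ/κ})^{|X|}`.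
Route, as printed: "sums over X_α with x_{j,α} = x_j" and "n such sets ⇒ Σ_n(…)^n/n! ≤ exp" = the product `Π(1 + b) ≤ exp Σ b` over
the triplets at each point (`prod_small_le`, `prod_one_add_le_exp`); "a combinatoric factor c^{|X_α|} controls each sum over X_α"
= the tree's lattice-animal lemma `Literature.Probability.LatticeModels.sum_pow_card_le_of_connected` (`animal_sum_two_le`,
`sum_big_inr_le`, `sum_big_inl_le`); "absorbed into e^{−cr|X_α|^−}" + "worst-case analysis of the unused small factors" = the
singleton/non-singleton split of a covering (`coverSum_le_split`, `hitSum_le`, `coverSum_le_bigSum`) with every cube not under a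
large polymer paying a singleton weight `≥ κ` (`kappa_le_singWeight`, `prod_sdiff_singWeight_le`, `bigSum_le`), whence the
`κ^{|X|}` and the rate loss `θ ↦ θ/κ` (`sum_big_le`).
§6 REFUTATION OF THE DISPLAY AS PRINTED (`not_ineq5113_printed`): with the SAME `c` on both sides and the bare constant
`[e^β(L^kε/ε₀)]^{(n̄+1)|X|}`, (5.11.3) fails already for one cube carrying one level-0 large-field point: interaction
`W_{4,0} = −log(1+s)`, `W_{4,k} = −log(1+κ)` (`s = e_0^{1−α}e^{−cr(e_k)}`, `κ = [e^β(L^kε/ε₀)]^{n̄+1}`) satisfies (5.11.1)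
(`Ineq5111`), its activities satisfy the same bounds, and the left side is `s + κ + sκ > e^{s}κ` = the right side, for all
`0 < e_0 ≤ 1`, `α ≤ 1`, `cr(e_k) ≥ 0`, `0 < e^β(L^kε/ε₀) < 1` (`exp_mul_lt_of_small`).  The print's own sketch uses `c′` (not `c`) in
the exponential two lines below the display; the typed row keeps the display verbatim (sic).
§7 THE REPAIRED (5.11.3) IN THE PRINTED LETTERS: `ineq5113_repaired` — `Ineq5113 (cubeSys V) k (mayerSum a) e lfVol α c′ r(e_k) K′ n̄`
for every `c′, K′` with `θ + θ/κ + 4(Δ+1)²(θ/κ)² ≤ e^{−c′r(e_k)}` and `κ e^{κ + 4(Δ+1)²θ/κ} ≤ K′^{n̄+1}`, from activity bounds of the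
shape (5.11.1); `ineq5113_of_ineq5111` — the same from (5.11.1) on the interaction itself (`Ineq5111`) for the activities
`e^{−W} − 1` (`trW`, `act`), with the honest factor 2 of `|e^{−w} − 1| ≤ 2|w|` (`abs_act_le`); `ineq5113_of_activity_bounds` — the
general repackaging.  All hypotheses are explicit binders; 0 new `Prop` facts; nothing of the paper beyond the cited displays is
asserted, and the regions `Λ₅^{(j)′}`, `Λ₆^{(j+1)c}`, `B_{k−j−1}` enter only through the abstract point sets `lf j`.
-/

noncomputable section

open Finset
open Literature.Probability.LatticeModels (IsRConnected sum_pow_card_le_of_connected)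

namespace Literature.MathematicalPhysics.QuantumFieldTheory.BalabanImbrieJaffe1984to88.BIJ88Ineq5113Covering

/-! ## §1 The concrete covering sum of (5.11.3) -/

/-- The index set of the Mayer expansion (5.11.2): a triplet is either `(j, x_j, X)` with `j < k`
(left summand: `((j, x), X)`) or the distinguished `j = k` term `(k, x_k, X)`, one per polymer `X`
(right summand). [cite: BalabanImbrieJaffe1988, (5.11.2) p.299] -/
abbrev Trip (V Pt : Type) : Type := ((ℕ × Pt) × Finset V) ⊕ Finset V

namespace Trip

variable {V Pt : Type}

/-- The polymer `X_α` of a triplet `(j_α, x_{j,α}, X_α)`. [cite: BalabanImbrieJaffe1988, (5.11.2) p.299] -/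
def poly : Trip V Pt → Finset V
  | Sum.inl t => t.2
  | Sum.inr Y => Y

/-- Unfolding `poly` on a `j < k` triplet. [cite: BalabanImbrieJaffe1988, (5.11.2) p.299] -/
@[simp] theorem poly_inl (t : (ℕ × Pt) × Finset V) : poly (Sum.inl t : Trip V Pt) = t.2 := rfl

/-- Unfolding `poly` on a `j = k` triplet. [cite: BalabanImbrieJaffe1988, (5.11.2) p.299] -/
@[simp] theorem poly_inr (Y : Finset V) : poly (Sum.inr Y : Trip V Pt) = Y := rfl

end Trip

variable {V : Type} [DecidableEq V] {Pt : Type} [DecidableEq Pt]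

section Model

variable (R : V → V → Prop) (k : ℕ) (lf : ℕ → Finset Pt) (home : Pt → V)

/-- The points `x_j ∈ B_{k−j−1}(Y) ∩ Λ₅^{(j)′} ∩ Λ₆^{(j+1)c}` of (5.11.1): the level-`j` large-field points
(`lf j`) lying in the polymer `Y` (`home x` = the `r(e_k)`-cube containing `x`).
[cite: BalabanImbrieJaffe1988, (5.11.1) p.299] -/
def pts (j : ℕ) (Y : Finset V) : Finset Pt := (lf j).filter fun x => home x ∈ Y

/-- `|B_{k−j−1}(Y) ∩ Λ₅^{(j)′} ∩ Λ₆^{(j+1)c}|` = the number of level-`j` large-field points in `Y`.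
[cite: BalabanImbrieJaffe1988, (5.11.1) p.299] -/
def lfVol (j : ℕ) (Y : Finset V) : ℕ := (pts lf home j Y).card

/-- The polymers inside `X`: nonempty `R`-connected unions of `r(e_k)`-cubes contained in `X` (p. 289: *"X's are
arbitrary connected unions of r(e_k)-cubes"*). [cite: BalabanImbrieJaffe1988, (5.7.5) p.289] -/
def polys (X : Finset V) : Finset (Finset V) := by
  classical exact X.powerset.filter fun Y => IsRConnected R Y

/-- All large-field points of the levels `j < k`. [cite: BalabanImbrieJaffe1988, (5.11.1) p.299] -/
def lfPts : Finset Pt := (range k).biUnion lf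

/-- The `j < k` triplets `(j, x_j, Y)` of S̄₄ with `Y ⊆ X`: `j < k`, `Y` a polymer inside `X`, `x_j` a level-`j`
large-field point in `Y`. [cite: BalabanImbrieJaffe1988, (5.11.1) p.299] -/
def tripJ (X : Finset V) : Finset ((ℕ × Pt) × Finset V) :=
  ((range k ×ˢ lfPts k lf) ×ˢ polys R X).filter fun t => t.1.2 ∈ pts lf home t.1.1 t.2

/-- All triplets of S̄₄ whose polymer lies inside `X` (the `j < k` ones and one `j = k` triplet per polymer).
[cite: BalabanImbrieJaffe1988, (5.11.2) p.299] -/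
def trips (X : Finset V) : Finset (Trip V Pt) := (tripJ R k lf home X).disjSum (polys R X)

/-- The index set of the left side of (5.11.3): the sets `S₄ = {(j_α, x_{j,α}, X_α)}` of triplets with
`⋃_α X_α = X`. [cite: BalabanImbrieJaffe1988, (5.11.3) p.299] -/
def covers (X : Finset V) : Finset (Finset (Trip V Pt)) :=
  (trips R k lf home X).powerset.filter fun S => S.biUnion Trip.poly = X

/-- The left side of (5.11.3) without the absolute value, for activities `a` (`a (j_α, x_{j,α}, X_α)` ↤
`e^{−W_{4,j}^{(k)}(x_{j,α}, X_α)} − 1`): `Σ_{S₄ : ⋃_α X_α = X} Π_α a(α)`. [cite: BalabanImbrieJaffe1988, (5.11.3) p.299] -/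
def mayerSum (a : Trip V Pt → ℝ) (X : Finset V) : ℝ :=
  ∑ S ∈ covers R k lf home X, ∏ t ∈ S, a t

/-- The activities of (5.11.2)/(5.11.3): `e^{−W(t)} − 1`. [cite: BalabanImbrieJaffe1988, (5.11.2) p.299] -/
def act (W : Trip V Pt → ℝ) (t : Trip V Pt) : ℝ := Real.exp (-W t) - 1

/-- The polymer bookkeeping of `BIJ88Sect5StatementsPart2` instantiated by finite sets of cubes with their
cardinality `|X|`. [cite: BalabanImbrieJaffe1988, (5.7.5) p.289] -/
def cubeSys (V : Type) : BIJ88Sect5StatementsPart2.PolymerSys := ⟨Finset V, Finset.card⟩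

omit [DecidableEq V] in
/-- `|X|` in `cubeSys` is the number of cubes. [cite: BalabanImbrieJaffe1988, (5.7.5) p.289] -/
@[simp] theorem cubeSys_card (X : Finset V) : (cubeSys V).card X = X.card := rfl

omit [DecidableEq V] in
/-- `|X|^− = |X| − 1` (natural-number subtraction) in `cubeSys`. [cite: BalabanImbrieJaffe1988, (5.7.7) p.290] -/
@[simp] theorem cubeSys_cardMinus (X : Finset V) : (cubeSys V).cardMinus X = X.card - 1 := rfl

variable {R k lf home}

omit [DecidableEq Pt] in
/-- Membership in `pts`. [cite: BalabanImbrieJaffe1988, (5.11.1) p.299] -/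
theorem mem_pts {j : ℕ} {Y : Finset V} {x : Pt} : x ∈ pts lf home j Y ↔ x ∈ lf j ∧ home x ∈ Y := by
  simp [pts]

omit [DecidableEq Pt] in
/-- `pts` is monotone in the polymer. [cite: BalabanImbrieJaffe1988, (5.11.1) p.299] -/
theorem pts_mono {j : ℕ} {Y Z : Finset V} (h : Y ⊆ Z) : pts lf home j Y ⊆ pts lf home j Z := by
  intro x hx
  rw [mem_pts] at hx ⊢
  exact ⟨hx.1, h hx.2⟩

omit [DecidableEq V] in
/-- Membership in `polys`. [cite: BalabanImbrieJaffe1988, (5.7.5) p.289] -/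
theorem mem_polys {X Y : Finset V} : Y ∈ polys R X ↔ Y ⊆ X ∧ IsRConnected R Y := by
  unfold polys
  simp only [mem_filter, mem_powerset]

omit [DecidableEq V] in
/-- Polymers are nonempty. [cite: BalabanImbrieJaffe1988, (5.7.5) p.289] -/
theorem nonempty_of_mem_polys {X Y : Finset V} (h : Y ∈ polys R X) : Y.Nonempty := (mem_polys.1 h).2.1

omit [DecidableEq V] in
/-- Polymers have at least one cube. [cite: BalabanImbrieJaffe1988, (5.7.5) p.289] -/
theorem one_le_card_of_mem_polys {X Y : Finset V} (h : Y ∈ polys R X) : 1 ≤ Y.card :=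
  card_pos.2 (nonempty_of_mem_polys h)

omit [DecidableEq V] in
/-- A single cube of `X` is a polymer inside `X`. [cite: BalabanImbrieJaffe1988, (5.7.5) p.289] -/
theorem singleton_mem_polys {X : Finset V} {q : V} (hq : q ∈ X) : ({q} : Finset V) ∈ polys R X := by
  refine mem_polys.2 ⟨singleton_subset_iff.2 hq, singleton_nonempty q, ?_⟩
  intro v hv w hw
  rw [mem_singleton] at hv hw
  subst hv; subst hw
  exact Relation.ReflTransGen.refl

/-- Membership in `tripJ`. [cite: BalabanImbrieJaffe1988, (5.11.1) p.299] -/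
theorem mem_tripJ {X : Finset V} {t : (ℕ × Pt) × Finset V} :
    t ∈ tripJ R k lf home X ↔ t.1.1 < k ∧ t.2 ∈ polys R X ∧ t.1.2 ∈ pts lf home t.1.1 t.2 := by
  simp only [tripJ, mem_filter, mem_product, mem_range]
  constructor
  · rintro ⟨⟨⟨hj, -⟩, hY⟩, hx⟩
    exact ⟨hj, hY, hx⟩
  · rintro ⟨hj, hY, hx⟩
    refine ⟨⟨⟨hj, ?_⟩, hY⟩, hx⟩
    exact mem_biUnion.2 ⟨t.1.1, mem_range.2 hj, (mem_pts.1 hx).1⟩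

/-- Membership of a `j < k` triplet in `trips`. [cite: BalabanImbrieJaffe1988, (5.11.2) p.299] -/
theorem inl_mem_trips {X : Finset V} {t : (ℕ × Pt) × Finset V} :
    (Sum.inl t : Trip V Pt) ∈ trips R k lf home X ↔ t ∈ tripJ R k lf home X := Finset.inl_mem_disjSum

/-- Membership of a `j = k` triplet in `trips`. [cite: BalabanImbrieJaffe1988, (5.11.2) p.299] -/
theorem inr_mem_trips {X : Finset V} {Y : Finset V} :
    (Sum.inr Y : Trip V Pt) ∈ trips R k lf home X ↔ Y ∈ polys R X := Finset.inr_mem_disjSum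

/-- The polymer of a triplet over `X` is a polymer inside `X`. [cite: BalabanImbrieJaffe1988, (5.11.2) p.299] -/
theorem poly_mem_polys {X : Finset V} {t : Trip V Pt} (ht : t ∈ trips R k lf home X) : t.poly ∈ polys R X := by
  rcases t with t | Y
  · exact (mem_tripJ.1 (inl_mem_trips.1 ht)).2.1
  · exact inr_mem_trips.1 ht

/-- The polymer of a triplet over `X` lies inside `X`. [cite: BalabanImbrieJaffe1988, (5.11.2) p.299] -/
theorem poly_subset {X : Finset V} {t : Trip V Pt} (ht : t ∈ trips R k lf home X) : t.poly ⊆ X :=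
  (mem_polys.1 (poly_mem_polys ht)).1

/-- Membership in `covers`. [cite: BalabanImbrieJaffe1988, (5.11.3) p.299] -/
theorem mem_covers {X : Finset V} {S : Finset (Trip V Pt)} :
    S ∈ covers R k lf home X ↔ S ⊆ trips R k lf home X ∧ S.biUnion Trip.poly = X := by
  simp only [covers, mem_filter, mem_powerset]

end Model

/-! ## §2 The covering combinatorics (the p. 299 sketch made exact) -/

section Combinatorics

variable (R : V → V → Prop) (k : ℕ) (lf : ℕ → Finset Pt) (home : Pt → V)

/-- Majorant of the left side of (5.11.3): the covering sum of nonnegative weights `b`.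
[cite: BalabanImbrieJaffe1988, (5.11.3) p.299] -/
def coverSum (b : Trip V Pt → ℝ) (X : Finset V) : ℝ := ∑ S ∈ covers R k lf home X, ∏ t ∈ S, b t

/-- The triplets over `X` whose polymer is a single cube. [cite: BalabanImbrieJaffe1988, (5.11.3) p.299] -/
def tripsSmall (X : Finset V) : Finset (Trip V Pt) := (trips R k lf home X).filter fun t => t.poly.card = 1

/-- The triplets over `X` whose polymer has at least two cubes. [cite: BalabanImbrieJaffe1988, (5.11.3) p.299] -/
def tripsBig (X : Finset V) : Finset (Trip V Pt) := (trips R k lf home X).filter fun t => t.poly.card ≠ 1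

/-- Total weight of the single-cube triplets sitting at the cube `q` (p. 299: the factor collected *"at each
x_j"* for the one-cube polymers). [cite: BalabanImbrieJaffe1988, (5.11.3) p.299] -/
def singWeight (b : Trip V Pt → ℝ) (X : Finset V) (q : V) : ℝ :=
  ∑ t ∈ (tripsSmall R k lf home X).filter (fun t => t.poly = {q}), b t

/-- Sum over the sets of single-cube triplets hitting every cube of `A`. [cite: BalabanImbrieJaffe1988, (5.11.3) p.299] -/
def hitSum (b : Trip V Pt → ℝ) (X A : Finset V) : ℝ :=
  ∑ S ∈ (tripsSmall R k lf home X).powerset.filter (fun S => ∀ q ∈ A, ∃ t ∈ S, t.poly = {q}), ∏ t ∈ S, b t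

variable {R k lf home}

/-- The left side of (5.11.3) is majorized by the covering sum of any termwise majorant of the activities.
[cite: BalabanImbrieJaffe1988, (5.11.3) p.299] -/
theorem abs_mayerSum_le_coverSum {a b : Trip V Pt → ℝ} {X : Finset V}
    (hab : ∀ t ∈ trips R k lf home X, |a t| ≤ b t) :
    |mayerSum R k lf home a X| ≤ coverSum R k lf home b X := by
  unfold mayerSum coverSum
  refine (abs_sum_le_sum_abs _ _).trans (sum_le_sum fun S hS => ?_)
  rw [abs_prod]
  have hST : S ⊆ trips R k lf home X := (mem_covers.1 hS).1
  exact prod_le_prod (fun t _ => abs_nonneg _) fun t ht => hab t (hST ht)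

/-- `hitSum` of the empty constraint is the full product `Π (1 + b)`. [cite: BalabanImbrieJaffe1988, (5.11.3) p.299] -/
theorem hitSum_empty (b : Trip V Pt → ℝ) (X : Finset V) :
    hitSum R k lf home b X ∅ = ∏ t ∈ tripsSmall R k lf home X, (1 + b t) := by
  unfold hitSum
  rw [prod_one_add, filter_true_of_mem]
  intro S _ q hq
  exact absurd hq (Finset.notMem_empty q)

/-- One induction step for `hitSum`: adding a cube `q₀ ∉ A` to the constraint costs at most the factor
`singWeight q₀`. [cite: BalabanImbrieJaffe1988, (5.11.3) p.299] -/
theorem hitSum_insert_le {b : Trip V Pt → ℝ} (hb : ∀ t, 0 ≤ b t) (X : Finset V) {A : Finset V} {q₀ : V}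
    (hq₀ : q₀ ∉ A) :
    hitSum R k lf home b X (insert q₀ A) ≤ singWeight R k lf home b X q₀ * hitSum R k lf home b X A := by
  classical
  set T₁ := tripsSmall R k lf home X with hT₁
  set P : Finset (Finset (Trip V Pt)) := T₁.powerset.filter (fun S => ∀ q ∈ A, ∃ t ∈ S, t.poly = {q})
    with hP
  have hprod_nonneg : ∀ S : Finset (Trip V Pt), 0 ≤ ∏ t ∈ S, b t := fun S => prod_nonneg fun t _ => hb t
  -- (i) insert the multiplicity of the witnesses for `q₀`, and relax the constraint to `A`
  have h1 : hitSum R k lf home b X (insert q₀ A) ≤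
      ∑ S ∈ P, (∏ t ∈ S, b t) * ((S.filter fun t => t.poly = {q₀}).card : ℝ) := by
    unfold hitSum
    rw [← hT₁]
    calc ∑ S ∈ T₁.powerset.filter (fun S => ∀ q ∈ insert q₀ A, ∃ t ∈ S, t.poly = {q}), ∏ t ∈ S, b t
        ≤ ∑ S ∈ T₁.powerset.filter (fun S => ∀ q ∈ insert q₀ A, ∃ t ∈ S, t.poly = {q}),
            (∏ t ∈ S, b t) * ((S.filter fun t => t.poly = {q₀}).card : ℝ) := by
          refine sum_le_sum fun S hS => ?_
          have hw : ∃ t ∈ S, t.poly = {q₀} := (mem_filter.1 hS).2 q₀ (mem_insert_self _ _)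
          have hcard : (1 : ℝ) ≤ ((S.filter fun t => t.poly = {q₀}).card : ℝ) := by
            obtain ⟨t, htS, ht⟩ := hw
            exact_mod_cast card_pos.2 ⟨t, mem_filter.2 ⟨htS, ht⟩⟩
          calc ∏ t ∈ S, b t = (∏ t ∈ S, b t) * 1 := (mul_one _).symm
            _ ≤ (∏ t ∈ S, b t) * ((S.filter fun t => t.poly = {q₀}).card : ℝ) :=
                mul_le_mul_of_nonneg_left hcard (hprod_nonneg S)
      _ ≤ ∑ S ∈ P, (∏ t ∈ S, b t) * ((S.filter fun t => t.poly = {q₀}).card : ℝ) := by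
          refine sum_le_sum_of_subset_of_nonneg ?_ fun S _ _ => mul_nonneg (hprod_nonneg S) (Nat.cast_nonneg _)
          intro S hS
          rw [mem_filter] at hS
          exact mem_filter.2 ⟨hS.1, fun q hq => hS.2 q (mem_insert_of_mem hq)⟩
  -- (ii) multiplicity as a sum, (iii) exchange of summations
  have h2 : ∑ S ∈ P, (∏ t ∈ S, b t) * ((S.filter fun t => t.poly = {q₀}).card : ℝ)
      = ∑ t ∈ T₁.filter (fun t => t.poly = {q₀}), ∑ S ∈ P.filter (fun S => t ∈ S), ∏ u ∈ S, b u := by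
    have : ∀ S ∈ P, (∏ t ∈ S, b t) * ((S.filter fun t => t.poly = {q₀}).card : ℝ)
        = ∑ _t ∈ S.filter (fun t => t.poly = {q₀}), ∏ u ∈ S, b u := by
      intro S _
      rw [sum_const, nsmul_eq_mul, mul_comm]
    rw [sum_congr rfl this]
    refine sum_comm' ?_
    intro S t
    constructor
    · rintro ⟨hS, ht⟩
      have hST : S ⊆ T₁ := mem_powerset.1 (mem_filter.1 hS).1
      exact ⟨mem_filter.2 ⟨hS, (mem_filter.1 ht).1⟩, mem_filter.2 ⟨hST (mem_filter.1 ht).1, (mem_filter.1 ht).2⟩⟩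
    · rintro ⟨hS, ht⟩
      exact ⟨(mem_filter.1 hS).1, mem_filter.2 ⟨(mem_filter.1 hS).2, (mem_filter.1 ht).2⟩⟩
  -- (iv) the inner sum: remove the witness `t`
  have h3 : ∀ t ∈ T₁.filter (fun t => t.poly = {q₀}),
      ∑ S ∈ P.filter (fun S => t ∈ S), ∏ u ∈ S, b u ≤ b t * hitSum R k lf home b X A := by
    intro t ht
    have hpt : t.poly = {q₀} := (mem_filter.1 ht).2
    set Pt' := P.filter (fun S => t ∈ S) with hPt'
    have hstep : ∀ S ∈ Pt', ∏ u ∈ S, b u = b t * ∏ u ∈ S.erase t, b u := by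
      intro S hS
      rw [mul_prod_erase S b (mem_filter.1 hS).2]
    rw [sum_congr rfl hstep, ← mul_sum]
    refine mul_le_mul_of_nonneg_left ?_ (hb t)
    have hinj : Set.InjOn (fun S : Finset (Trip V Pt) => S.erase t) Pt' := by
      intro S hS S' hS' h
      have htS : t ∈ S := (mem_filter.1 (Finset.mem_coe.1 hS)).2
      have htS' : t ∈ S' := (mem_filter.1 (Finset.mem_coe.1 hS')).2
      simp only at h
      rw [← insert_erase htS, ← insert_erase htS', h]
    rw [← sum_image (f := fun S' : Finset (Trip V Pt) => ∏ u ∈ S', b u) hinj]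
    unfold hitSum
    rw [← hT₁, ← hP]
    refine sum_le_sum_of_subset_of_nonneg ?_ fun S _ _ => hprod_nonneg S
    intro S' hS'
    obtain ⟨S, hS, rfl⟩ := mem_image.1 hS'
    have hSP : S ∈ P := (mem_filter.1 hS).1
    rw [mem_filter] at hSP
    refine mem_filter.2 ⟨mem_powerset.2 ((erase_subset t S).trans (mem_powerset.1 hSP.1)), fun q hq => ?_⟩
    obtain ⟨t', ht'S, ht'⟩ := hSP.2 q hq
    refine ⟨t', mem_erase.2 ⟨?_, ht'S⟩, ht'⟩
    rintro rfl
    rw [hpt, singleton_inj] at ht'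
    exact hq₀ (ht' ▸ hq)
  calc hitSum R k lf home b X (insert q₀ A)
      ≤ ∑ S ∈ P, (∏ t ∈ S, b t) * ((S.filter fun t => t.poly = {q₀}).card : ℝ) := h1
    _ = ∑ t ∈ T₁.filter (fun t => t.poly = {q₀}), ∑ S ∈ P.filter (fun S => t ∈ S), ∏ u ∈ S, b u := h2
    _ ≤ ∑ t ∈ T₁.filter (fun t => t.poly = {q₀}), b t * hitSum R k lf home b X A := sum_le_sum h3
    _ = singWeight R k lf home b X q₀ * hitSum R k lf home b X A := by
        rw [← sum_mul]
        rfl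

/-- The witness bound: the sets of single-cube triplets hitting every cube of `A` weigh at most
`Π_{q ∈ A} singWeight q · Π_{small t} (1 + b t)`. [cite: BalabanImbrieJaffe1988, (5.11.3) p.299] -/
theorem hitSum_le {b : Trip V Pt → ℝ} (hb : ∀ t, 0 ≤ b t) (X A : Finset V) :
    hitSum R k lf home b X A ≤
      (∏ q ∈ A, singWeight R k lf home b X q) * ∏ t ∈ tripsSmall R k lf home X, (1 + b t) := by
  classical
  induction A using Finset.induction_on with
  | empty => rw [hitSum_empty, prod_empty, one_mul]
  | insert q₀ A hq₀ ih =>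
    have hsw : 0 ≤ singWeight R k lf home b X q₀ := sum_nonneg fun t _ => hb t
    calc hitSum R k lf home b X (insert q₀ A)
        ≤ singWeight R k lf home b X q₀ * hitSum R k lf home b X A := hitSum_insert_le hb X hq₀
      _ ≤ singWeight R k lf home b X q₀ *
          ((∏ q ∈ A, singWeight R k lf home b X q) * ∏ t ∈ tripsSmall R k lf home X, (1 + b t)) :=
          mul_le_mul_of_nonneg_left ih hsw
      _ = (∏ q ∈ insert q₀ A, singWeight R k lf home b X q) * ∏ t ∈ tripsSmall R k lf home X, (1 + b t) := by
          rw [prod_insert hq₀, mul_assoc]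

/-- The cover decomposition (p. 299, the two kinds of polymers): splitting a covering `S₄` into its triplets with at
least two cubes (`S₂`) and its single-cube triplets (`S₁`), every cube of `X` outside `⋃ S₂` carries a single-cube
triplet of `S₁`; hence `coverSum ≤ Σ_{S₂} (Π_{S₂} b) · hitSum (X ∖ ⋃ S₂)`. [cite: BalabanImbrieJaffe1988, (5.11.3) p.299] -/
theorem coverSum_le_split {b : Trip V Pt → ℝ} (hb : ∀ t, 0 ≤ b t) (X : Finset V) :
    coverSum R k lf home b X ≤ ∑ S₂ ∈ (tripsBig R k lf home X).powerset,
      (∏ t ∈ S₂, b t) * hitSum R k lf home b X (X \ S₂.biUnion Trip.poly) := by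
  classical
  set T := trips R k lf home X with hT
  set T₁ := tripsSmall R k lf home X with hT₁
  set T₂ := tripsBig R k lf home X with hT₂
  set big : Trip V Pt → Prop := fun t => t.poly.card ≠ 1 with hbig
  set Φ : Finset (Trip V Pt) → Finset (Trip V Pt) × Finset (Trip V Pt) :=
    fun S => (S.filter big, S.filter fun t => ¬ big t) with hΦ
  set cond : Finset (Trip V Pt) × Finset (Trip V Pt) → Prop :=
    fun p => ∀ q ∈ X \ p.1.biUnion Trip.poly, ∃ t ∈ p.2, t.poly = {q} with hcond
  set D := (T₂.powerset ×ˢ T₁.powerset).filter cond with hD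
  set w : Finset (Trip V Pt) × Finset (Trip V Pt) → ℝ := fun p => (∏ t ∈ p.1, b t) * ∏ t ∈ p.2, b t with hw
  have hprod_nonneg : ∀ S : Finset (Trip V Pt), 0 ≤ ∏ t ∈ S, b t := fun S => prod_nonneg fun t _ => hb t
  have hwS : ∀ S ∈ covers R k lf home X, ∏ t ∈ S, b t = w (Φ S) := by
    intro S _
    exact (prod_filter_mul_prod_filter_not S big b).symm
  have hinj : Set.InjOn Φ (covers R k lf home X) := by
    intro S _ S' _ h
    have h1 : S.filter big = S'.filter big := congrArg Prod.fst h
    have h2 : (S.filter fun t => ¬ big t) = S'.filter fun t => ¬ big t := congrArg Prod.snd h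
    rw [← filter_union_filter_not_eq big S, ← filter_union_filter_not_eq big S', h1, h2]
  have hmaps : ∀ S ∈ covers R k lf home X, Φ S ∈ D := by
    intro S hS
    obtain ⟨hST, hcov⟩ := mem_covers.1 hS
    refine mem_filter.2 ⟨mem_product.2 ⟨mem_powerset.2 ?_, mem_powerset.2 ?_⟩, ?_⟩
    · exact filter_subset_filter big hST
    · intro t ht
      obtain ⟨htS, hnb⟩ := mem_filter.1 ht
      exact mem_filter.2 ⟨hST htS, not_not.1 hnb⟩
    · intro q hq
      obtain ⟨hqX, hqW⟩ := mem_sdiff.1 hq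
      rw [← hcov, mem_biUnion] at hqX
      obtain ⟨t, htS, hqt⟩ := hqX
      by_cases hbt : big t
      · exact absurd (mem_biUnion.2 ⟨t, mem_filter.2 ⟨htS, hbt⟩, hqt⟩) hqW
      · obtain ⟨q', hq'⟩ := card_eq_one.1 (not_not.1 hbt)
        refine ⟨t, mem_filter.2 ⟨htS, hbt⟩, ?_⟩
        rw [hq'] at hqt ⊢
        rw [mem_singleton.1 hqt]
  calc coverSum R k lf home b X = ∑ S ∈ covers R k lf home X, w (Φ S) := sum_congr rfl hwS
    _ = ∑ p ∈ (covers R k lf home X).image Φ, w p := (sum_image hinj).symm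
    _ ≤ ∑ p ∈ D, w p := by
        refine sum_le_sum_of_subset_of_nonneg (image_subset_iff.2 hmaps) fun p _ _ => ?_
        exact mul_nonneg (hprod_nonneg p.1) (hprod_nonneg p.2)
    _ = ∑ S₂ ∈ T₂.powerset, ∑ S₁ ∈ T₁.powerset, if cond (S₂, S₁) then w (S₂, S₁) else 0 := by
        rw [hD, sum_filter, sum_product]
    _ = ∑ S₂ ∈ T₂.powerset, (∏ t ∈ S₂, b t) * hitSum R k lf home b X (X \ S₂.biUnion Trip.poly) := by
        refine sum_congr rfl fun S₂ _ => ?_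
        rw [← sum_filter, hitSum, mul_sum]

/-- Assembly of §2: for every nonnegative weight `b`,
`coverSum b X ≤ Π_{small}(1 + b) · Σ_{S₂ ⊆ big} (Π_{S₂} b) · Π_{q ∈ X ∖ ⋃S₂} singWeight q`.
[cite: BalabanImbrieJaffe1988, (5.11.3) p.299] -/
theorem coverSum_le_bigSum {b : Trip V Pt → ℝ} (hb : ∀ t, 0 ≤ b t) (X : Finset V) :
    coverSum R k lf home b X ≤ (∏ t ∈ tripsSmall R k lf home X, (1 + b t)) *
      ∑ S₂ ∈ (tripsBig R k lf home X).powerset,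
        (∏ t ∈ S₂, b t) * ∏ q ∈ X \ S₂.biUnion Trip.poly, singWeight R k lf home b X q := by
  refine (coverSum_le_split hb X).trans ?_
  rw [mul_sum]
  refine sum_le_sum fun S₂ _ => ?_
  have hP : 0 ≤ ∏ t ∈ S₂, b t := prod_nonneg fun t _ => hb t
  calc (∏ t ∈ S₂, b t) * hitSum R k lf home b X (X \ S₂.biUnion Trip.poly)
      ≤ (∏ t ∈ S₂, b t) * ((∏ q ∈ X \ S₂.biUnion Trip.poly, singWeight R k lf home b X q) *
          ∏ t ∈ tripsSmall R k lf home X, (1 + b t)) := mul_le_mul_of_nonneg_left (hitSum_le hb X _) hP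
    _ = (∏ t ∈ tripsSmall R k lf home X, (1 + b t)) *
          ((∏ t ∈ S₂, b t) * ∏ q ∈ X \ S₂.biUnion Trip.poly, singWeight R k lf home b X q) := by ring

end Combinatorics

/-! ## §3 The (5.11.1)-type majorant: weights, large-field bookkeeping, lattice animals -/

section Estimates

variable (R : V → V → Prop) (k : ℕ) (lf : ℕ → Finset Pt) (home : Pt → V)

/-- The majorant of the activities in the letters of the proof: `ε_j θ^{|Y|}` for a `j < k` triplet, `κ θ^{|Y|−1}` for
a `j = k` triplet (`ε_j ↤ e_j^{1−α}`, `θ ↤ e^{−cr(e_k)}`, `κ ↤ [e^β(L^kε/ε₀)]^{n̄+1}`; cf. (5.11.1) and *"Note that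
e^{−W}−1 satisfies the same bound as W"*, p. 299). [cite: BalabanImbrieJaffe1988, (5.11.1) p.299] -/
def bnd (ε : ℕ → ℝ) (θ κ : ℝ) : Trip V Pt → ℝ
  | Sum.inl t => ε t.1.1 * θ ^ t.2.card
  | Sum.inr Y => κ * θ ^ (Y.card - 1)

/-- The large-field weight sitting at one cube: `τ(q) = Σ_{j<k} ε_j · #{level-j large-field points in q}`.
[cite: BalabanImbrieJaffe1988, (5.11.3) p.299] -/
def tau (ε : ℕ → ℝ) (q : V) : ℝ := ∑ j ∈ range k, ε j * ((pts lf home j {q}).card : ℝ)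

/-- The exponent of (5.11.3) without its small factor: `Σ_{j<k} ε_j |B_{k−j−1}(X) ∩ Λ₅^{(j)′} ∩ Λ₆^{(j+1)c}|`.
[cite: BalabanImbrieJaffe1988, (5.11.3) p.299] -/
def lfWeight (ε : ℕ → ℝ) (X : Finset V) : ℝ := ∑ j ∈ range k, ε j * (lfVol lf home j X : ℝ)

variable {R k lf home}

omit [DecidableEq V] [DecidableEq Pt] in
/-- Unfolding `bnd` on a `j < k` triplet. [cite: BalabanImbrieJaffe1988, (5.11.1) p.299] -/
@[simp] theorem bnd_inl (ε : ℕ → ℝ) (θ κ : ℝ) (t : (ℕ × Pt) × Finset V) :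
    bnd ε θ κ (Sum.inl t : Trip V Pt) = ε t.1.1 * θ ^ t.2.card := rfl

omit [DecidableEq V] [DecidableEq Pt] in
/-- Unfolding `bnd` on a `j = k` triplet. [cite: BalabanImbrieJaffe1988, (5.11.1) p.299] -/
@[simp] theorem bnd_inr (ε : ℕ → ℝ) (θ κ : ℝ) (Y : Finset V) :
    bnd ε θ κ (Sum.inr Y : Trip V Pt) = κ * θ ^ (Y.card - 1) := rfl

omit [DecidableEq V] [DecidableEq Pt] in
/-- The majorant is nonnegative. [cite: BalabanImbrieJaffe1988, (5.11.1) p.299] -/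
theorem bnd_nonneg {ε : ℕ → ℝ} {θ κ : ℝ} (hε : ∀ j, 0 ≤ ε j) (hθ : 0 ≤ θ) (hκ : 0 ≤ κ) (t : Trip V Pt) :
    0 ≤ bnd ε θ κ t := by
  rcases t with t | Y
  · exact mul_nonneg (hε _) (pow_nonneg hθ _)
  · exact mul_nonneg hκ (pow_nonneg hθ _)

omit [DecidableEq Pt] in
/-- `τ(q) ≥ 0`. [cite: BalabanImbrieJaffe1988, (5.11.3) p.299] -/
theorem tau_nonneg {ε : ℕ → ℝ} (hε : ∀ j, 0 ≤ ε j) (q : V) : 0 ≤ tau k lf home ε q :=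
  sum_nonneg fun j _ => mul_nonneg (hε j) (Nat.cast_nonneg _)

omit [DecidableEq Pt] in
/-- `lfWeight X ≥ 0`. [cite: BalabanImbrieJaffe1988, (5.11.3) p.299] -/
theorem lfWeight_nonneg {ε : ℕ → ℝ} (hε : ∀ j, 0 ≤ ε j) (X : Finset V) : 0 ≤ lfWeight k lf home ε X :=
  sum_nonneg fun j _ => mul_nonneg (hε j) (Nat.cast_nonneg _)

omit [DecidableEq Pt] in
/-- Fiberwise count of the large-field points of `X` over its cubes. [cite: BalabanImbrieJaffe1988, (5.11.1) p.299] -/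
theorem sum_card_pts_singleton (j : ℕ) (X : Finset V) :
    ∑ q ∈ X, (pts lf home j {q}).card = (pts lf home j X).card := by
  rw [card_eq_sum_card_fiberwise (f := home) (t := X) (fun x hx => (mem_pts.1 hx).2)]
  refine sum_congr rfl fun q hq => ?_
  congr 1
  ext x
  simp only [mem_pts, mem_filter, mem_singleton]
  constructor
  · rintro ⟨hx, rfl⟩
    exact ⟨⟨hx, hq⟩, rfl⟩
  · rintro ⟨⟨hx, -⟩, h⟩
    exact ⟨hx, h⟩

omit [DecidableEq Pt] in
/-- `Σ_{q ∈ X} τ(q) = Σ_j ε_j |B_{k−j−1}(X) ∩ …|`. [cite: BalabanImbrieJaffe1988, (5.11.3) p.299] -/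
theorem sum_tau_eq (ε : ℕ → ℝ) (X : Finset V) : ∑ q ∈ X, tau k lf home ε q = lfWeight k lf home ε X := by
  unfold tau lfWeight lfVol
  rw [sum_comm]
  refine sum_congr rfl fun j _ => ?_
  rw [← mul_sum, ← sum_card_pts_singleton (lf := lf) (home := home) j X, Nat.cast_sum]

/-- `Π (1 + f) ≤ exp (Σ f)` for `f ≥ 0`. [folklore] -/
private theorem prod_one_add_le_exp {ι : Type*} (s : Finset ι) {f : ι → ℝ} (hf : ∀ i ∈ s, 0 ≤ f i) :
    ∏ i ∈ s, (1 + f i) ≤ Real.exp (∑ i ∈ s, f i) := by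
  rw [Real.exp_sum]
  exact prod_le_prod (fun i hi => by linarith [hf i hi]) fun i _ => by
    rw [add_comm]; exact Real.add_one_le_exp _

/-- The total weight of the single-cube triplets is collected cube by cube.
[cite: BalabanImbrieJaffe1988, (5.11.3) p.299] -/
theorem sum_small_eq_sum_singWeight (b : Trip V Pt → ℝ) (X : Finset V) :
    ∑ t ∈ tripsSmall R k lf home X, b t = ∑ q ∈ X, singWeight R k lf home b X q := by
  classical
  have hmaps : ∀ t ∈ tripsSmall R k lf home X, t.poly ∈ X.image fun q => ({q} : Finset V) := by
    intro t ht
    obtain ⟨htT, hcard⟩ := mem_filter.1 ht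
    obtain ⟨q, hq⟩ := card_eq_one.1 hcard
    have hqX : q ∈ X := poly_subset htT (hq ▸ mem_singleton_self q)
    exact mem_image.2 ⟨q, hqX, hq.symm⟩
  rw [← sum_fiberwise_of_maps_to hmaps]
  rw [sum_image fun q _ q' _ h => singleton_injective h]
  rfl

/-- `κ ≤ singWeight q` for every cube `q` of `X` (the `j = k` triplet of the polymer `{q}`).
[cite: BalabanImbrieJaffe1988, (5.11.1) p.299] -/
theorem kappa_le_singWeight {ε : ℕ → ℝ} {θ κ : ℝ} (hε : ∀ j, 0 ≤ ε j) (hθ : 0 ≤ θ) (hκ : 0 ≤ κ)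
    {X : Finset V} {q : V} (hq : q ∈ X) : κ ≤ singWeight R k lf home (bnd ε θ κ) X q := by
  unfold singWeight
  have hmem : (Sum.inr {q} : Trip V Pt) ∈ (tripsSmall R k lf home X).filter (fun t => t.poly = {q}) := by
    refine mem_filter.2 ⟨mem_filter.2 ⟨inr_mem_trips.2 (singleton_mem_polys hq), ?_⟩, rfl⟩
    simp
  have h := single_le_sum (f := bnd ε θ κ) (fun t _ => bnd_nonneg hε hθ hκ t) hmem
  simpa using h

/-- `singWeight q ≤ κ + θ τ(q)`: at the cube `q` sit the `j = k` triplet of `{q}` (weight `κ`) and the `j < k` triplets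
`(j, x_j, {q})`, `x_j` a level-`j` large-field point in `q` (weight `ε_j θ` each). [cite: BalabanImbrieJaffe1988, (5.11.1) p.299] -/
theorem singWeight_le {ε : ℕ → ℝ} {θ κ : ℝ} (hε : ∀ j, 0 ≤ ε j) (hθ : 0 ≤ θ) (hκ : 0 ≤ κ)
    (X : Finset V) (q : V) : singWeight R k lf home (bnd ε θ κ) X q ≤ κ + θ * tau k lf home ε q := by
  classical
  have hb := bnd_nonneg (V := V) (Pt := Pt) hε hθ hκ
  -- enlarge to all triplets over `X` with polymer `{q}`, split into the two kinds
  have h1 : singWeight R k lf home (bnd ε θ κ) X q ≤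
      ∑ t ∈ (trips R k lf home X).filter (fun t => t.poly = {q}), bnd ε θ κ t := by
    refine sum_le_sum_of_subset_of_nonneg (fun t ht => ?_) fun t _ _ => hb t
    exact mem_filter.2 ⟨(mem_filter.1 (mem_filter.1 ht).1).1, (mem_filter.1 ht).2⟩
  have h2 : ∑ t ∈ (trips R k lf home X).filter (fun t => t.poly = {q}), bnd ε θ κ t =
      (∑ u ∈ tripJ R k lf home X, if u.2 = {q} then bnd ε θ κ (Sum.inl u : Trip V Pt) else 0) +
        ∑ Y ∈ polys R X, if Y = {q} then bnd ε θ κ (Sum.inr Y : Trip V Pt) else 0 := by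
    rw [sum_filter, trips, sum_disjSum]
    rfl
  -- the `j = k` part
  have h3 : ∑ Y ∈ polys R X, (if Y = {q} then bnd ε θ κ (Sum.inr Y : Trip V Pt) else 0) ≤ κ := by
    rw [sum_ite_eq']
    split_ifs
    · simp
    · exact hκ
  -- the `j < k` part
  have h4 : ∑ u ∈ tripJ R k lf home X, (if u.2 = {q} then bnd ε θ κ (Sum.inl u : Trip V Pt) else 0) ≤
      θ * tau k lf home ε q := by
    rw [← sum_filter]
    set F := (tripJ R k lf home X).filter (fun u => u.2 = {q}) with hF
    have hF1 : ∀ u ∈ F, bnd ε θ κ (Sum.inl u) = θ * ε u.1.1 := by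
      intro u hu
      rw [bnd_inl, (mem_filter.1 hu).2, card_singleton, pow_one, mul_comm]
    rw [sum_congr rfl hF1, ← mul_sum]
    refine mul_le_mul_of_nonneg_left ?_ hθ
    have hinj : Set.InjOn (fun u : (ℕ × Pt) × Finset V => u.1) F := by
      intro u hu u' hu' h
      have h2u : u.2 = {q} := (mem_filter.1 (Finset.mem_coe.1 hu)).2
      have h2u' : u'.2 = {q} := (mem_filter.1 (Finset.mem_coe.1 hu')).2
      exact Prod.ext h (h2u.trans h2u'.symm)
    rw [← sum_image (f := fun d : ℕ × Pt => ε d.1) hinj]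
    set E := (range k ×ˢ lfPts k lf).filter (fun d => d.2 ∈ pts lf home d.1 {q}) with hE
    calc ∑ d ∈ F.image (fun u => u.1), ε d.1 ≤ ∑ d ∈ E, ε d.1 := by
          refine sum_le_sum_of_subset_of_nonneg (fun d hd => ?_) fun d _ _ => hε _
          obtain ⟨u, hu, rfl⟩ := mem_image.1 hd
          obtain ⟨huT, hu2⟩ := mem_filter.1 hu
          have hu' := mem_tripJ.1 huT
          refine mem_filter.2 ⟨mem_product.2 ⟨mem_range.2 hu'.1, ?_⟩, hu2 ▸ hu'.2.2⟩
          exact mem_biUnion.2 ⟨u.1.1, mem_range.2 hu'.1, (mem_pts.1 hu'.2.2).1⟩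
      _ = tau k lf home ε q := by
          rw [hE, sum_filter, sum_product]
          unfold tau
          refine sum_congr rfl fun j hj => ?_
          dsimp only
          have hfil : (lfPts k lf).filter (fun a => a ∈ pts lf home j {q}) = pts lf home j {q} := by
            rw [filter_mem_eq_inter, inter_eq_right]
            intro x hx
            exact mem_biUnion.2 ⟨j, hj, (mem_pts.1 hx).1⟩
          rw [← sum_filter, hfil, sum_const, nsmul_eq_mul, mul_comm]
  linarith [h1, h2, h3, h4]

/-- The single-cube factor of the estimate: `Π_{small}(1 + b) ≤ exp(κ|X| + θ·Σ_j ε_j|B_{k−j−1}(X) ∩ …|)`.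
[cite: BalabanImbrieJaffe1988, (5.11.3) p.299] -/
theorem prod_small_le {ε : ℕ → ℝ} {θ κ : ℝ} (hε : ∀ j, 0 ≤ ε j) (hθ : 0 ≤ θ) (hκ : 0 ≤ κ) (X : Finset V) :
    ∏ t ∈ tripsSmall R k lf home X, (1 + bnd ε θ κ t) ≤
      Real.exp (κ * X.card + θ * lfWeight k lf home ε X) := by
  refine (prod_one_add_le_exp _ fun t _ => bnd_nonneg hε hθ hκ t).trans ?_
  rw [Real.exp_le_exp, sum_small_eq_sum_singWeight]
  calc ∑ q ∈ X, singWeight R k lf home (bnd ε θ κ) X q ≤ ∑ q ∈ X, (κ + θ * tau k lf home ε q) :=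
        sum_le_sum fun q _ => singWeight_le hε hθ hκ X q
    _ = κ * X.card + θ * lfWeight k lf home ε X := by
        rw [sum_add_distrib, sum_const, nsmul_eq_mul, ← mul_sum, sum_tau_eq]; ring

/-- The per-cube product: `Π_{q ∈ X} singWeight q ≤ κ^{|X|} exp((θ/κ)·Σ_j ε_j|B_{k−j−1}(X) ∩ …|)` — the
`[e^β(L^kε/ε₀)]^{(n̄+1)|X|}` and the `exp(Σ_j …)` of (5.11.3). [cite: BalabanImbrieJaffe1988, (5.11.3) p.299] -/
theorem prod_singWeight_le {ε : ℕ → ℝ} {θ κ : ℝ} (hε : ∀ j, 0 ≤ ε j) (hθ : 0 ≤ θ) (hκ : 0 < κ) (X : Finset V) :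
    ∏ q ∈ X, singWeight R k lf home (bnd ε θ κ) X q ≤
      κ ^ X.card * Real.exp (θ / κ * lfWeight k lf home ε X) := by
  have h0 : ∀ q ∈ X, 0 ≤ singWeight R k lf home (bnd ε θ κ) X q :=
    fun q _ => sum_nonneg fun t _ => bnd_nonneg hε hθ hκ.le t
  calc ∏ q ∈ X, singWeight R k lf home (bnd ε θ κ) X q ≤ ∏ q ∈ X, (κ + θ * tau k lf home ε q) :=
        prod_le_prod h0 fun q _ => singWeight_le hε hθ hκ.le X q
    _ = ∏ q ∈ X, (κ * (1 + θ / κ * tau k lf home ε q)) := by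
        refine prod_congr rfl fun q _ => ?_
        field_simp
    _ = κ ^ X.card * ∏ q ∈ X, (1 + θ / κ * tau k lf home ε q) := by
        rw [prod_mul_distrib, prod_const]
    _ ≤ κ ^ X.card * Real.exp (θ / κ * lfWeight k lf home ε X) := by
        refine mul_le_mul_of_nonneg_left ?_ (pow_nonneg hκ.le _)
        refine (prod_one_add_le_exp _ fun q _ => mul_nonneg (div_nonneg hθ hκ.le) (tau_nonneg hε q)).trans ?_
        rw [← mul_sum, sum_tau_eq]

end Estimates

/-! ## §4 The polymers with at least two cubes: lattice animals (the *"combinatoric factor c^{|X_α|}"*) -/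

section Animals

variable {R : V → V → Prop} {k : ℕ} {lf : ℕ → Finset Pt} {home : Pt → V}

omit [DecidableEq Pt] in
/-- Lattice-animal bound for the polymers with at least two cubes through a fixed cube: if `2(Δ+1)²λ ≤ 1` then
`Σ_{Y ∋ q, |Y| ≥ 2} λ^{|Y|} ≤ 4(Δ+1)²λ²` (from the tree's `sum_pow_card_le_of_connected` at the maximal admissible
activity `1/(2(Δ+1)²)`). This is the p. 299 *"combinatoric factor c^{|X_α|} … absorbed into the factors e^{−cr(e_k)|X|^−}"*.
[cite: BalabanImbrieJaffe1988, (5.11.3) p.299] -/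
theorem animal_sum_two_le (hR : ∀ x y, R x y → R y x) {nbr : V → Finset V} {Δ : ℕ} (hΔ : ∀ x, (nbr x).card ≤ Δ)
    (hnbr : ∀ x y, R x y → y ∈ nbr x) {lam : ℝ} (hlam0 : 0 ≤ lam) (hlam : 2 * ((Δ : ℝ) + 1) ^ 2 * lam ≤ 1)
    (q : V) (𝒴 : Finset (Finset V)) (h𝒴 : ∀ Y ∈ 𝒴, q ∈ Y ∧ IsRConnected R Y ∧ 2 ≤ Y.card) :
    ∑ Y ∈ 𝒴, lam ^ Y.card ≤ 4 * ((Δ : ℝ) + 1) ^ 2 * lam ^ 2 := by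
  have hD : (0 : ℝ) < ((Δ : ℝ) + 1) ^ 2 := by positivity
  set L : ℝ := 1 / (2 * ((Δ : ℝ) + 1) ^ 2) with hL
  have hL0 : 0 < L := by positivity
  have hlamL : lam ≤ L := by
    rw [hL, le_div_iff₀ (by positivity)]
    linarith
  have hLsmall : ((Δ : ℝ) + 1) ^ 2 * L ≤ 1 / 2 := by
    rw [hL]
    field_simp
    rfl
  have key := sum_pow_card_le_of_connected hR hΔ hnbr hL0.le hLsmall q 𝒴
    (fun Y hY => ⟨(h𝒴 Y hY).1, (h𝒴 Y hY).2.1⟩)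
  have hterm : ∀ Y ∈ 𝒴, lam ^ Y.card ≤ lam ^ 2 / L ^ 2 * L ^ Y.card := by
    intro Y hY
    obtain ⟨m, hm⟩ : ∃ m, Y.card = m + 2 := ⟨Y.card - 2, by have := (h𝒴 Y hY).2.2; omega⟩
    have hpow : lam ^ m ≤ L ^ m := pow_le_pow_left₀ hlam0 hlamL m
    rw [hm, pow_add, pow_add]
    calc lam ^ m * lam ^ 2 ≤ L ^ m * lam ^ 2 := by gcongr
      _ = lam ^ 2 / L ^ 2 * (L ^ m * L ^ 2) := by field_simp
  calc ∑ Y ∈ 𝒴, lam ^ Y.card ≤ ∑ Y ∈ 𝒴, lam ^ 2 / L ^ 2 * L ^ Y.card := sum_le_sum hterm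
    _ = lam ^ 2 / L ^ 2 * ∑ Y ∈ 𝒴, L ^ Y.card := by rw [mul_sum]
    _ ≤ lam ^ 2 / L ^ 2 * (2 * L) := by gcongr
    _ = 4 * ((Δ : ℝ) + 1) ^ 2 * lam ^ 2 := by
        rw [hL]
        field_simp
        ring

omit [DecidableEq Pt] in
/-- Same with one power less: `Σ_{Y ∋ q, |Y| ≥ 2} λ^{|Y|−1} ≤ 4(Δ+1)²λ`. [cite: BalabanImbrieJaffe1988, (5.11.3) p.299] -/
theorem animal_sum_two_pred_le (hR : ∀ x y, R x y → R y x) {nbr : V → Finset V} {Δ : ℕ}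
    (hΔ : ∀ x, (nbr x).card ≤ Δ) (hnbr : ∀ x y, R x y → y ∈ nbr x) {lam : ℝ} (hlam0 : 0 ≤ lam)
    (hlam : 2 * ((Δ : ℝ) + 1) ^ 2 * lam ≤ 1) (q : V) (𝒴 : Finset (Finset V))
    (h𝒴 : ∀ Y ∈ 𝒴, q ∈ Y ∧ IsRConnected R Y ∧ 2 ≤ Y.card) :
    ∑ Y ∈ 𝒴, lam ^ (Y.card - 1) ≤ 4 * ((Δ : ℝ) + 1) ^ 2 * lam := by
  have hD : (0 : ℝ) < ((Δ : ℝ) + 1) ^ 2 := by positivity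
  set L : ℝ := 1 / (2 * ((Δ : ℝ) + 1) ^ 2) with hL
  have hL0 : 0 < L := by positivity
  have hlamL : lam ≤ L := by
    rw [hL, le_div_iff₀ (by positivity)]
    linarith
  have hLsmall : ((Δ : ℝ) + 1) ^ 2 * L ≤ 1 / 2 := by
    rw [hL]
    field_simp
    rfl
  have key := sum_pow_card_le_of_connected hR hΔ hnbr hL0.le hLsmall q 𝒴
    (fun Y hY => ⟨(h𝒴 Y hY).1, (h𝒴 Y hY).2.1⟩)
  have hterm : ∀ Y ∈ 𝒴, lam ^ (Y.card - 1) ≤ lam / L ^ 2 * L ^ Y.card := by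
    intro Y hY
    obtain ⟨m, hm⟩ : ∃ m, Y.card = m + 2 := ⟨Y.card - 2, by have := (h𝒴 Y hY).2.2; omega⟩
    have hpow : lam ^ m ≤ L ^ m := pow_le_pow_left₀ hlam0 hlamL m
    rw [hm, show m + 2 - 1 = m + 1 by omega, pow_succ, pow_add]
    calc lam ^ m * lam ≤ L ^ m * lam := by gcongr
      _ = lam / L ^ 2 * (L ^ m * L ^ 2) := by field_simp
  calc ∑ Y ∈ 𝒴, lam ^ (Y.card - 1) ≤ ∑ Y ∈ 𝒴, lam / L ^ 2 * L ^ Y.card := sum_le_sum hterm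
    _ = lam / L ^ 2 * ∑ Y ∈ 𝒴, L ^ Y.card := by rw [mul_sum]
    _ ≤ lam / L ^ 2 * (2 * L) := by gcongr
    _ = 4 * ((Δ : ℝ) + 1) ^ 2 * lam := by
        rw [hL]
        field_simp
        ring

omit [DecidableEq Pt] in
/-- Counting each polymer once per cube it contains: for nonempty `Y ⊆ X` and `f ≥ 0`,
`Σ_Y f(Y) ≤ Σ_{q ∈ X} Σ_{Y ∋ q} f(Y)`. [folklore] -/
private theorem sum_le_sum_sum_mem {𝒴 : Finset (Finset V)} {X : Finset V} (h𝒴 : ∀ Y ∈ 𝒴, Y ⊆ X ∧ Y.Nonempty)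
    {f : Finset V → ℝ} (hf : ∀ Y ∈ 𝒴, 0 ≤ f Y) :
    ∑ Y ∈ 𝒴, f Y ≤ ∑ q ∈ X, ∑ Y ∈ 𝒴.filter (fun Y => q ∈ Y), f Y := by
  have h : ∑ q ∈ X, ∑ Y ∈ 𝒴.filter (fun Y => q ∈ Y), f Y = ∑ Y ∈ 𝒴, (Y.card : ℝ) * f Y := by
    simp_rw [sum_filter]
    rw [sum_comm]
    refine sum_congr rfl fun Y hY => ?_
    rw [← sum_filter, sum_const, nsmul_eq_mul]
    congr 2
    rw [filter_mem_eq_inter, inter_eq_right.2 (h𝒴 Y hY).1]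
  rw [h]
  refine sum_le_sum fun Y hY => ?_
  have h1 : (1 : ℝ) ≤ Y.card := by exact_mod_cast card_pos.2 (h𝒴 Y hY).2
  calc f Y = 1 * f Y := (one_mul _).symm
    _ ≤ (Y.card : ℝ) * f Y := mul_le_mul_of_nonneg_right h1 (hf Y hY)

/-- The `j = k` polymers with at least two cubes: `Σ_{Y ⊆ X, |Y| ≥ 2} (θ/κ)^{|Y|−1} ≤ 4(Δ+1)²(θ/κ)|X|`.
[cite: BalabanImbrieJaffe1988, (5.11.3) p.299] -/
theorem sum_big_inr_le (hR : ∀ x y, R x y → R y x) {nbr : V → Finset V} {Δ : ℕ} (hΔ : ∀ x, (nbr x).card ≤ Δ)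
    (hnbr : ∀ x y, R x y → y ∈ nbr x) {lam : ℝ} (hlam0 : 0 ≤ lam) (hlam : 2 * ((Δ : ℝ) + 1) ^ 2 * lam ≤ 1)
    (X : Finset V) :
    ∑ Y ∈ (polys R X).filter (fun Y => 2 ≤ Y.card), lam ^ (Y.card - 1) ≤
      4 * ((Δ : ℝ) + 1) ^ 2 * lam * X.card := by
  set P2 := (polys R X).filter (fun Y => 2 ≤ Y.card) with hP2
  have hP2X : ∀ Y ∈ P2, Y ⊆ X ∧ Y.Nonempty := fun Y hY =>
    ⟨(mem_polys.1 (mem_filter.1 hY).1).1, nonempty_of_mem_polys (mem_filter.1 hY).1⟩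
  refine (sum_le_sum_sum_mem hP2X fun Y _ => pow_nonneg hlam0 _).trans ?_
  calc ∑ q ∈ X, ∑ Y ∈ P2.filter (fun Y => q ∈ Y), lam ^ (Y.card - 1)
      ≤ ∑ q ∈ X, 4 * ((Δ : ℝ) + 1) ^ 2 * lam := by
        refine sum_le_sum fun q _ => animal_sum_two_pred_le hR hΔ hnbr hlam0 hlam q _ fun Y hY => ?_
        obtain ⟨hYP, hqY⟩ := mem_filter.1 hY
        obtain ⟨hYp, h2⟩ := mem_filter.1 hYP
        exact ⟨hqY, (mem_polys.1 hYp).2, h2⟩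
    _ = 4 * ((Δ : ℝ) + 1) ^ 2 * lam * X.card := by rw [sum_const, nsmul_eq_mul]; ring

/-- The `j < k` polymers with at least two cubes, collected at their large-field points:
`Σ_{(j,x,Y), |Y| ≥ 2} ε_j (θ/κ)^{|Y|} ≤ 4(Δ+1)²(θ/κ)² Σ_j ε_j|B_{k−j−1}(X) ∩ …|` (p. 299: the factor collected *"at
each x_j"*). [cite: BalabanImbrieJaffe1988, (5.11.3) p.299] -/
theorem sum_big_inl_le (hR : ∀ x y, R x y → R y x) {nbr : V → Finset V} {Δ : ℕ} (hΔ : ∀ x, (nbr x).card ≤ Δ)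
    (hnbr : ∀ x y, R x y → y ∈ nbr x) {ε : ℕ → ℝ} (hε : ∀ j, 0 ≤ ε j) {lam : ℝ} (hlam0 : 0 ≤ lam)
    (hlam : 2 * ((Δ : ℝ) + 1) ^ 2 * lam ≤ 1) (X : Finset V) :
    ∑ u ∈ (tripJ R k lf home X).filter (fun u => 2 ≤ u.2.card), ε u.1.1 * lam ^ u.2.card ≤
      4 * ((Δ : ℝ) + 1) ^ 2 * lam ^ 2 * lfWeight k lf home ε X := by
  classical
  set C : ℝ := 4 * ((Δ : ℝ) + 1) ^ 2 * lam ^ 2 with hC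
  have hC0 : 0 ≤ C := by positivity
  set D := range k ×ˢ lfPts k lf with hD
  -- rewrite the sum as an iterated sum over `d = (j, x)` and the polymers
  have h1 : ∑ u ∈ (tripJ R k lf home X).filter (fun u => 2 ≤ u.2.card), ε u.1.1 * lam ^ u.2.card =
      ∑ d ∈ D, ε d.1 * ∑ Y ∈ (polys R X).filter (fun Y => d.2 ∈ pts lf home d.1 Y ∧ 2 ≤ Y.card),
        lam ^ Y.card := by
    rw [tripJ, filter_filter, sum_filter, ← hD, sum_product]
    refine sum_congr rfl fun d _ => ?_
    rw [mul_sum, ← sum_filter]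
  rw [h1]
  -- bound the inner sum at each `d`
  have h2 : ∀ d ∈ D, ε d.1 * ∑ Y ∈ (polys R X).filter (fun Y => d.2 ∈ pts lf home d.1 Y ∧ 2 ≤ Y.card),
      lam ^ Y.card ≤ ε d.1 * (if d.2 ∈ pts lf home d.1 X then C else 0) := by
    intro d _
    refine mul_le_mul_of_nonneg_left ?_ (hε _)
    split_ifs with hx
    · refine animal_sum_two_le hR hΔ hnbr hlam0 hlam (home d.2) _ fun Y hY => ?_
      obtain ⟨hYp, hxY, h2⟩ := mem_filter.1 hY
      exact ⟨(mem_pts.1 hxY).2, (mem_polys.1 hYp).2, h2⟩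
    · refine le_of_eq (sum_eq_zero fun Y hY => ?_)
      obtain ⟨hYp, hxY, -⟩ := mem_filter.1 hY
      exact absurd (pts_mono (mem_polys.1 hYp).1 hxY) hx
  refine (sum_le_sum h2).trans ?_
  -- collect `Σ_d ε_{d.1} 1[d.2 ∈ pts d.1 X] = Σ_j ε_j |pts j X|`
  rw [hD, sum_product]
  unfold lfWeight lfVol
  rw [mul_sum]
  refine le_of_eq (sum_congr rfl fun j hj => ?_)
  dsimp only
  have hfil : (lfPts k lf).filter (fun x => x ∈ pts lf home j X) = pts lf home j X := by
    rw [filter_mem_eq_inter, inter_eq_right]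
    intro x hx
    exact mem_biUnion.2 ⟨j, hj, (mem_pts.1 hx).1⟩
  simp_rw [mul_ite, mul_zero]
  rw [← sum_filter, hfil, sum_const, nsmul_eq_mul]
  ring

end Animals

/-! ## §5 The repaired (5.11.3) in the letters of the proof -/

section Main

variable {R : V → V → Prop} {k : ℕ} {lf : ℕ → Finset Pt} {home : Pt → V}

/-- The polymers with at least two cubes pay their volume in units of `κ`: for `S₂ ⊆ tripsBig X`,
`Π_{q ∈ X ∖ ⋃S₂} singWeight q ≤ (Π_{q ∈ X} singWeight q) · Π_{t ∈ S₂} κ^{−|X_t|}` (p. 299: *"There remains a factor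
[e^β(L^kε/ε₀)]^{(n̄+1)|X|} from a worst-case analysis of the unused small factors"*). [cite: BalabanImbrieJaffe1988, (5.11.3) p.299] -/
theorem prod_sdiff_singWeight_le {ε : ℕ → ℝ} {θ κ : ℝ} (hε : ∀ j, 0 ≤ ε j) (hθ : 0 ≤ θ) (hκ0 : 0 < κ)
    (hκ1 : κ ≤ 1) (X : Finset V) {S₂ : Finset (Trip V Pt)} (hS₂ : S₂ ⊆ tripsBig R k lf home X) :
    ∏ q ∈ X \ S₂.biUnion Trip.poly, singWeight R k lf home (bnd ε θ κ) X q ≤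
      (∏ q ∈ X, singWeight R k lf home (bnd ε θ κ) X q) * ∏ t ∈ S₂, (κ⁻¹) ^ t.poly.card := by
  set B := singWeight R k lf home (bnd ε θ κ) X with hB
  set W := S₂.biUnion Trip.poly with hW
  have hST : ∀ t ∈ S₂, t ∈ trips R k lf home X := fun t ht => (mem_filter.1 (hS₂ ht)).1
  have hWX : W ⊆ X := biUnion_subset.2 fun t ht => poly_subset (hST t ht)
  have hB0 : ∀ q, 0 ≤ B q := fun q => sum_nonneg fun t _ => bnd_nonneg hε hθ hκ0.le t
  have hBW : κ ^ W.card ≤ ∏ q ∈ W, B q := by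
    rw [← prod_const]
    exact prod_le_prod (fun _ _ => hκ0.le) fun q hq => kappa_le_singWeight hε hθ hκ0.le (hWX hq)
  have hsd : (∏ q ∈ X \ W, B q) * ∏ q ∈ W, B q = ∏ q ∈ X, B q := prod_sdiff hWX
  have hpos : 0 < κ ^ W.card := pow_pos hκ0 _
  have h1 : ∏ q ∈ X \ W, B q ≤ (∏ q ∈ X, B q) * (κ⁻¹) ^ W.card := by
    rw [inv_pow, ← div_eq_mul_inv, le_div_iff₀ hpos, ← hsd]
    exact mul_le_mul_of_nonneg_left hBW (prod_nonneg fun q _ => hB0 q)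
  have h2 : (κ⁻¹) ^ W.card ≤ ∏ t ∈ S₂, (κ⁻¹) ^ t.poly.card := by
    rw [prod_pow_eq_pow_sum]
    exact pow_le_pow_right₀ (one_le_inv_iff₀.2 ⟨hκ0, hκ1⟩) card_biUnion_le
  exact h1.trans (mul_le_mul_of_nonneg_left h2 (prod_nonneg fun q _ => hB0 q))

/-- Resummation of the polymers with at least two cubes:
`Σ_{S₂ ⊆ big} (Π_{S₂} b) Π_{q ∈ X ∖ ⋃S₂} singWeight q ≤ (Π_{q ∈ X} singWeight q) · Π_{t big} (1 + b_t κ^{−|X_t|})`.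
[cite: BalabanImbrieJaffe1988, (5.11.3) p.299] -/
theorem bigSum_le {ε : ℕ → ℝ} {θ κ : ℝ} (hε : ∀ j, 0 ≤ ε j) (hθ : 0 ≤ θ) (hκ0 : 0 < κ) (hκ1 : κ ≤ 1)
    (X : Finset V) :
    ∑ S₂ ∈ (tripsBig R k lf home X).powerset,
        (∏ t ∈ S₂, bnd ε θ κ t) * ∏ q ∈ X \ S₂.biUnion Trip.poly, singWeight R k lf home (bnd ε θ κ) X q ≤
      (∏ q ∈ X, singWeight R k lf home (bnd ε θ κ) X q) *
        ∏ t ∈ tripsBig R k lf home X, (1 + bnd ε θ κ t * (κ⁻¹) ^ t.poly.card) := by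
  have hb := bnd_nonneg (V := V) (Pt := Pt) hε hθ hκ0.le
  set B := singWeight R k lf home (bnd ε θ κ) X with hB
  have hPB : 0 ≤ ∏ q ∈ X, B q := prod_nonneg fun q _ => sum_nonneg fun t _ => hb t
  calc ∑ S₂ ∈ (tripsBig R k lf home X).powerset, (∏ t ∈ S₂, bnd ε θ κ t) * ∏ q ∈ X \ S₂.biUnion Trip.poly, B q
      ≤ ∑ S₂ ∈ (tripsBig R k lf home X).powerset,
          (∏ q ∈ X, B q) * ∏ t ∈ S₂, (bnd ε θ κ t * (κ⁻¹) ^ t.poly.card) := by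
        refine sum_le_sum fun S₂ hS₂ => ?_
        have hS₂' : S₂ ⊆ tripsBig R k lf home X := mem_powerset.1 hS₂
        calc (∏ t ∈ S₂, bnd ε θ κ t) * ∏ q ∈ X \ S₂.biUnion Trip.poly, B q
            ≤ (∏ t ∈ S₂, bnd ε θ κ t) * ((∏ q ∈ X, B q) * ∏ t ∈ S₂, (κ⁻¹) ^ t.poly.card) :=
              mul_le_mul_of_nonneg_left (prod_sdiff_singWeight_le hε hθ hκ0 hκ1 X hS₂')
                (prod_nonneg fun t _ => hb t)
          _ = (∏ q ∈ X, B q) * ∏ t ∈ S₂, (bnd ε θ κ t * (κ⁻¹) ^ t.poly.card) := by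
              rw [prod_mul_distrib]; ring
    _ = (∏ q ∈ X, B q) * ∏ t ∈ tripsBig R k lf home X, (1 + bnd ε θ κ t * (κ⁻¹) ^ t.poly.card) := by
        rw [← mul_sum, prod_one_add]

/-- Algebra of the `j = k` weights: `κ θ^{m−1} κ^{−m} = (θ/κ)^{m−1}` for `m ≥ 1`. [folklore] -/
private theorem kappa_mul_pow_mul_inv_pow {θ κ : ℝ} (hκ : κ ≠ 0) {m : ℕ} (hm : 1 ≤ m) :
    κ * θ ^ (m - 1) * (κ⁻¹) ^ m = (θ / κ) ^ (m - 1) := by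
  obtain ⟨n, rfl⟩ : ∃ n, m = n + 1 := ⟨m - 1, by omega⟩
  rw [Nat.add_sub_cancel, pow_succ, div_pow, div_eq_mul_inv, ← inv_pow]
  field_simp

/-- The exponent collected from the polymers with at least two cubes:
`Σ_{t big} b_t κ^{−|X_t|} ≤ 4(Δ+1)²(θ/κ)|X| + 4(Δ+1)²(θ/κ)² Σ_j ε_j|B_{k−j−1}(X) ∩ …|`.
[cite: BalabanImbrieJaffe1988, (5.11.3) p.299] -/
theorem sum_big_le (hR : ∀ x y, R x y → R y x) {nbr : V → Finset V} {Δ : ℕ} (hΔ : ∀ x, (nbr x).card ≤ Δ)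
    (hnbr : ∀ x y, R x y → y ∈ nbr x) {ε : ℕ → ℝ} {θ κ : ℝ} (hε : ∀ j, 0 ≤ ε j) (hθ : 0 ≤ θ) (hκ0 : 0 < κ)
    (hsmall : 2 * ((Δ : ℝ) + 1) ^ 2 * θ ≤ κ) (X : Finset V) :
    ∑ t ∈ tripsBig R k lf home X, bnd ε θ κ t * (κ⁻¹) ^ t.poly.card ≤
      4 * ((Δ : ℝ) + 1) ^ 2 * (θ / κ) * X.card +
        4 * ((Δ : ℝ) + 1) ^ 2 * (θ / κ) ^ 2 * lfWeight k lf home ε X := by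
  classical
  have hlam0 : 0 ≤ θ / κ := div_nonneg hθ hκ0.le
  have hlam : 2 * ((Δ : ℝ) + 1) ^ 2 * (θ / κ) ≤ 1 := by
    rw [← mul_div_assoc, div_le_one hκ0]
    exact hsmall
  -- on `trips X`, "not a single cube" means "at least two cubes"
  have h1 : ∑ t ∈ tripsBig R k lf home X, bnd ε θ κ t * (κ⁻¹) ^ t.poly.card =
      ∑ t ∈ (trips R k lf home X).filter (fun t => 2 ≤ t.poly.card), bnd ε θ κ t * (κ⁻¹) ^ t.poly.card := by
    refine sum_congr ?_ fun _ _ => rfl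
    refine filter_congr fun t ht => ?_
    have := one_le_card_of_mem_polys (poly_mem_polys ht)
    omega
  have h2 : ∑ t ∈ (trips R k lf home X).filter (fun t => 2 ≤ t.poly.card), bnd ε θ κ t * (κ⁻¹) ^ t.poly.card =
      (∑ u ∈ (tripJ R k lf home X).filter (fun u => 2 ≤ u.2.card), ε u.1.1 * (θ / κ) ^ u.2.card) +
        ∑ Y ∈ (polys R X).filter (fun Y => 2 ≤ Y.card), (θ / κ) ^ (Y.card - 1) := by
    rw [sum_filter, trips, sum_disjSum, ← sum_filter, ← sum_filter]
    congr 1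
    · refine sum_congr rfl fun u _ => ?_
      rw [Trip.poly_inl, bnd_inl, mul_assoc, ← mul_pow, ← div_eq_mul_inv]
    · refine sum_congr rfl fun Y hY => ?_
      rw [Trip.poly_inr, bnd_inr]
      exact kappa_mul_pow_mul_inv_pow hκ0.ne' (one_le_card_of_mem_polys (mem_filter.1 hY).1)
  rw [h1, h2, add_comm]
  exact add_le_add (sum_big_inr_le hR hΔ hnbr hlam0 hlam X) (sum_big_inl_le hR hΔ hnbr hε hlam0 hlam X)

/-- **The repaired (5.11.3)** (p. 299, in the letters of the proof). Polymers = nonempty `R`-connected unions of cubes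
of a symmetric adjacency `R` of degree `≤ Δ`; activities `a` with `|a(j, x_j, Y)| ≤ ε_j θ^{|Y|}` (`j < k`) and
`|a(k, x_k, Y)| ≤ κ θ^{|Y|−1}`, `0 < κ ≤ 1`; under the smallness `2(Δ+1)²θ ≤ κ` (the print's *"worst-case analysis"*:
`e^{−cr(e_k)}` below `[e^β(L^kε/ε₀)]^{n̄+1}`):
`|Σ_{S₄ : ⋃X_α = X} Π_α a(α)| ≤ exp((θ + θ/κ + 4(Δ+1)²(θ/κ)²) Σ_{j<k} ε_j|B_{k−j−1}(X) ∩ Λ₅^{(j)′} ∩ Λ₆^{(j+1)c}|) ·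
(κ · e^{κ + 4(Δ+1)²θ/κ})^{|X|}` — i.e. (5.11.3) with `e^{−cr(e_k)}` replaced by `e^{−c′r(e_k)} := θ + θ/κ + 4(Δ+1)²(θ/κ)²`
(the `c′` the print itself uses two lines below the display) and `[e^β(L^kε/ε₀)]^{n̄+1}` by `κ e^{κ + 4(Δ+1)²θ/κ}`.
Route = the p. 299 sketch: combinatoric factor per polymer by the lattice-animal bound, an exponential at each `x_j`,
`κ^{|X|}` from the covering. [cite: BalabanImbrieJaffe1988, (5.11.3) p.299] -/
theorem abs_mayerSum_le (hR : ∀ x y, R x y → R y x) {nbr : V → Finset V} {Δ : ℕ} (hΔ : ∀ x, (nbr x).card ≤ Δ)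
    (hnbr : ∀ x y, R x y → y ∈ nbr x) {ε : ℕ → ℝ} {θ κ : ℝ} (hε : ∀ j, 0 ≤ ε j) (hθ : 0 ≤ θ) (hκ0 : 0 < κ)
    (hκ1 : κ ≤ 1) (hsmall : 2 * ((Δ : ℝ) + 1) ^ 2 * θ ≤ κ) {a : Trip V Pt → ℝ} (X : Finset V)
    (ha : ∀ t ∈ trips R k lf home X, |a t| ≤ bnd ε θ κ t) :
    |mayerSum R k lf home a X| ≤
      Real.exp ((θ + θ / κ + 4 * ((Δ : ℝ) + 1) ^ 2 * (θ / κ) ^ 2) * lfWeight k lf home ε X) *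
        (κ * Real.exp (κ + 4 * ((Δ : ℝ) + 1) ^ 2 * (θ / κ))) ^ X.card := by
  have hb := bnd_nonneg (V := V) (Pt := Pt) hε hθ hκ0.le
  set s := lfWeight k lf home ε X with hs
  set n := X.card with hn
  set C₁ : ℝ := 4 * ((Δ : ℝ) + 1) ^ 2 with hC₁
  set A := ∏ t ∈ tripsSmall R k lf home X, (1 + bnd ε θ κ t) with hA
  set B := ∏ q ∈ X, singWeight R k lf home (bnd ε θ κ) X q with hB
  set C := ∏ t ∈ tripsBig R k lf home X, (1 + bnd ε θ κ t * (κ⁻¹) ^ t.poly.card) with hC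
  have hA0 : 0 ≤ A := prod_nonneg fun t _ => by linarith [hb t]
  have hB0 : 0 ≤ B := prod_nonneg fun q _ => sum_nonneg fun t _ => hb t
  have hg0 : ∀ t, 0 ≤ bnd ε θ κ t * (κ⁻¹) ^ t.poly.card :=
    fun t => mul_nonneg (hb t) (pow_nonneg (inv_nonneg.2 hκ0.le) _)
  have hC0 : 0 ≤ C := prod_nonneg fun t _ => by linarith [hg0 t]
  have h0 : |mayerSum R k lf home a X| ≤ A * (B * C) := by
    refine (abs_mayerSum_le_coverSum ha).trans ((coverSum_le_bigSum hb X).trans ?_)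
    exact mul_le_mul_of_nonneg_left (bigSum_le hε hθ hκ0 hκ1 X) hA0
  have hA1 : A ≤ Real.exp (κ * n + θ * s) := prod_small_le hε hθ hκ0.le X
  have hB1 : B ≤ κ ^ n * Real.exp (θ / κ * s) := prod_singWeight_le hε hθ hκ0 X
  have hC1 : C ≤ Real.exp (C₁ * (θ / κ) * n + C₁ * (θ / κ) ^ 2 * s) := by
    refine (prod_one_add_le_exp _ fun t _ => hg0 t).trans ?_
    rw [Real.exp_le_exp]
    exact sum_big_le hR hΔ hnbr hε hθ hκ0 hsmall X
  have hkey : Real.exp (κ * n + θ * s) * (κ ^ n * Real.exp (θ / κ * s) *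
      Real.exp (C₁ * (θ / κ) * n + C₁ * (θ / κ) ^ 2 * s)) =
      Real.exp ((θ + θ / κ + C₁ * (θ / κ) ^ 2) * s) * (κ * Real.exp (κ + C₁ * (θ / κ))) ^ n := by
    rw [mul_pow, ← Real.exp_nat_mul]
    have h3 : ∀ u v w : ℝ, Real.exp u * (κ ^ n * Real.exp v * Real.exp w) = κ ^ n * Real.exp (u + v + w) := by
      intro u v w; rw [Real.exp_add, Real.exp_add]; ring
    have h4 : ∀ u v : ℝ, Real.exp u * (κ ^ n * Real.exp v) = κ ^ n * Real.exp (u + v) := by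
      intro u v; rw [Real.exp_add]; ring
    rw [h3, h4]
    exact congrArg (fun u => κ ^ n * Real.exp u) (by ring)
  calc |mayerSum R k lf home a X| ≤ A * (B * C) := h0
    _ ≤ Real.exp (κ * n + θ * s) * (κ ^ n * Real.exp (θ / κ * s) *
          Real.exp (C₁ * (θ / κ) * n + C₁ * (θ / κ) ^ 2 * s)) := by
        refine mul_le_mul hA1 (mul_le_mul hB1 hC1 hC0 ?_) (mul_nonneg hB0 hC0) (Real.exp_pos _).le
        exact mul_nonneg (pow_nonneg hκ0.le _) (Real.exp_pos _).le
    _ = _ := hkey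

end Main

/-! ## §6 (5.11.3) with the printed constants fails: one cube, one large-field point -/

section Counterexample

open BIJ88Sect5StatementsPart2 (Ineq5111 Ineq5113)

/-- The elementary inequality behind the counterexample: `κ e^s < s + κ + sκ` for `0 < s ≤ 1`, `0 < κ`, `κs < 1`
(from `e^s ≤ 1 + s + s²` on `[0, 1]`). [folklore] -/
private theorem exp_mul_lt_of_small {s κ : ℝ} (hs0 : 0 < s) (hs1 : s ≤ 1) (hκ0 : 0 < κ) (hκs : κ * s < 1) :
    Real.exp s * κ < s + κ + s * κ := by
  have h := Real.abs_exp_sub_one_sub_id_le (x := s) (by rwa [abs_of_pos hs0])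
  have h1 : Real.exp s ≤ 1 + s + s ^ 2 := by
    have := (abs_le.1 h).2
    linarith
  have h2 : κ * s ^ 2 < s := by
    have := mul_pos hs0 (sub_pos.2 hκs)
    nlinarith
  calc Real.exp s * κ ≤ (1 + s + s ^ 2) * κ := mul_le_mul_of_nonneg_right h1 hκ0.le
    _ = κ + s * κ + κ * s ^ 2 := by ring
    _ < s + κ + s * κ := by linarith

/-- The interaction of the one-cube model: `W_{4,0}^{(k)}(x_0, X) = −log(1 + s)` and `W_{4,k}^{(k)}(x_k, X) = −log(1 + κ)`,
so that the activities `e^{−W} − 1` of (5.11.2) are exactly `s` and `κ`. [cite: BalabanImbrieJaffe1988, (5.11.2) p.299] -/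
def ctrW (s κ : ℝ) : Trip Unit Unit → ℝ
  | Sum.inl _ => -Real.log (1 + s)
  | Sum.inr _ => -Real.log (1 + κ)

/-- The `j < k` activity of the one-cube model is `s`. [cite: BalabanImbrieJaffe1988, (5.11.2) p.299] -/
theorem act_ctrW_inl {s κ : ℝ} (hs : 0 < 1 + s) (t : (ℕ × Unit) × Finset Unit) :
    act (ctrW s κ) (Sum.inl t) = s := by
  simp only [act, ctrW, neg_neg, Real.exp_log hs]
  ring

/-- The `j = k` activity of the one-cube model is `κ`. [cite: BalabanImbrieJaffe1988, (5.11.2) p.299] -/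
theorem act_ctrW_inr {s κ : ℝ} (hκ : 0 < 1 + κ) (Y : Finset Unit) : act (ctrW s κ) (Sum.inr Y) = κ := by
  simp only [act, ctrW, neg_neg, Real.exp_log hκ]
  ring

/-- **(5.11.3) fails with the printed constants.** One `r(e_k)`-cube (`V = Unit`, any adjacency `R`), `k = 1`, one
level-`0` large-field point in it (`Pt = Unit`); `s := e_0^{1−α} e^{−cr(e_k)}`, `κ := [e^β(L^kε/ε₀)]^{n̄+1}`, interaction
`ctrW s κ`. Then: the bounds (5.11.1) hold (`Ineq5111`, first conjunct); the activities `e^{−W} − 1` obey the same bounds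
(second conjunct — p. 299: *"Note that e^{−W_{4,j}^{(k)}(x_j, X)} − 1 satisfies the same bound as W_{4,j}^{(k)}(x_j, X)"*); but at
`X` = the cube the left side of (5.11.3) is `s + κ + sκ` (coverings `{(0,x_0,X)}`, `{(k,x_k,X)}`, `{(0,x_0,X),(k,x_k,X)}`), which
exceeds the printed right side `e^{s} κ` whenever `0 < e_0 ≤ 1`, `α ≤ 1`, `cr(e_k) ≥ 0`, `0 < e^β(L^kε/ε₀) < 1` (third conjunct).
So (5.11.3) holds only with a smaller rate `c′ < c` in the exponential — the `c′` of the proof sketch two lines below the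
display — and a constant larger than `[e^β(L^kε/ε₀)]^{n̄+1}`: see `ineq5113_repaired`. [cite: BalabanImbrieJaffe1988, (5.11.3) p.299] -/
theorem not_ineq5113_printed (R : Unit → Unit → Prop) {e : ℕ → ℝ} {α c rk K : ℝ} {nbar : ℕ} {s κ : ℝ}
    (hs : s = e 0 ^ (1 - α) * Real.exp (-(c * rk))) (hκ : κ = K ^ (nbar + 1))
    (he0 : 0 < e 0) (he1 : e 0 ≤ 1) (hα : α ≤ 1) (hc : 0 ≤ c * rk) (hK0 : 0 < K) (hK1 : K < 1) :
    Ineq5111 (cubeSys Unit) Unit 1 (fun _ _ _ => -Real.log (1 + s)) (fun _ => -Real.log (1 + κ)) e α c rk K nbar ∧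
    (∀ X, ∀ t ∈ trips R 1 (fun _ => ({()} : Finset Unit)) id X,
        |act (ctrW s κ) t| ≤ bnd (fun j => e j ^ (1 - α)) (Real.exp (-(c * rk))) κ t) ∧
    ¬ Ineq5113 (cubeSys Unit) 1 (mayerSum R 1 (fun _ => ({()} : Finset Unit)) id (act (ctrW s κ))) e
        (lfVol (fun _ => ({()} : Finset Unit)) id) α c rk K nbar := by
  -- the numbers of the model
  have hθ0 : 0 < Real.exp (-(c * rk)) := Real.exp_pos _
  have hθ1 : Real.exp (-(c * rk)) ≤ 1 := Real.exp_le_one_iff.2 (by linarith)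
  have hε0 : 0 < e 0 ^ (1 - α) := Real.rpow_pos_of_pos he0 _
  have hε1 : e 0 ^ (1 - α) ≤ 1 := Real.rpow_le_one he0.le he1 (by linarith)
  have hs0 : 0 < s := by rw [hs]; exact mul_pos hε0 hθ0
  have hs1 : s ≤ 1 := by rw [hs]; exact mul_le_one₀ hε1 hθ0.le hθ1
  have hκ0 : 0 < κ := by rw [hκ]; exact pow_pos hK0 _
  have hκ1 : κ < 1 := by rw [hκ]; exact pow_lt_one₀ hK0.le hK1 (Nat.succ_ne_zero _)
  have hlogs0 : 0 ≤ Real.log (1 + s) := Real.log_nonneg (by linarith)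
  have hlogs1 : Real.log (1 + s) ≤ s := by linarith [Real.log_le_sub_one_of_pos (by linarith : (0 : ℝ) < 1 + s)]
  have hlogκ0 : 0 ≤ Real.log (1 + κ) := Real.log_nonneg (by linarith)
  have hlogκ1 : Real.log (1 + κ) ≤ κ := by linarith [Real.log_le_sub_one_of_pos (by linarith : (0 : ℝ) < 1 + κ)]
  have hcard : ∀ Y : Finset Unit, Y.card ≤ 1 := fun Y => (card_le_univ Y).trans_eq Fintype.card_unit
  have ha0 : ∀ t, 0 ≤ act (ctrW s κ) t := by
    rintro (t | Y)
    · rw [act_ctrW_inl (by linarith)]; exact hs0.le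
    · rw [act_ctrW_inr (by linarith)]; exact hκ0.le
  refine ⟨⟨?_, ?_⟩, ?_, ?_⟩
  · -- (5.11.1), j < k
    intro j hj x X
    dsimp only
    rw [abs_neg, abs_of_nonneg hlogs0]
    refine hlogs1.trans ?_
    have hj0 : j = 0 := by omega
    subst hj0
    rw [hs]
    refine mul_le_mul_of_nonneg_left (Real.exp_le_exp.2 ?_) hε0.le
    have h1 : ((cubeSys Unit).card X : ℝ) ≤ 1 := by
      rw [cubeSys_card]; exact_mod_cast hcard X
    have := mul_le_of_le_one_right hc h1
    linarith
  · -- (5.11.1), j = k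
    intro X
    dsimp only
    have h0 : (cubeSys Unit).cardMinus X = 0 := by
      rw [cubeSys_cardMinus]; have := hcard X; omega
    rw [h0, Nat.cast_zero, mul_zero, Real.exp_zero, mul_one, abs_neg, abs_of_nonneg hlogκ0, ← hκ]
    exact hlogκ1
  · -- the activities obey the same bounds
    intro X t ht
    rcases t with t | Y
    · have ht' := mem_tripJ.1 (inl_mem_trips.1 ht)
      have hj : t.1.1 = 0 := by omega
      have hY1 : t.2.card = 1 := le_antisymm (hcard _) (one_le_card_of_mem_polys ht'.2.1)
      rw [act_ctrW_inl (by linarith), bnd_inl, hj, hY1, pow_one, abs_of_pos hs0, hs]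
    · have hY1 : Y.card = 1 := le_antisymm (hcard _) (one_le_card_of_mem_polys (inr_mem_trips.1 ht))
      rw [act_ctrW_inr (by linarith), bnd_inr, hY1, Nat.sub_self, pow_zero, mul_one, abs_of_pos hκ0]
  · -- (5.11.3) as printed fails at X = the cube
    intro h5113
    have hlf : lfVol (fun _ => ({()} : Finset Unit)) id 0 {()} = 1 := by
      unfold lfVol pts
      rw [filter_true_of_mem fun x _ => by simp, card_singleton]
    have hX := h5113 ({()} : Finset Unit)
    rw [sum_range_one, hlf, Nat.cast_one, mul_one, cubeSys_card, card_singleton, mul_one, ← hs, ← hκ] at hX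
    -- three of the coverings already beat the printed right side
    have hu : (() : Unit) ∈ ({()} : Finset Unit) := mem_singleton_self _
    have h1 : (Sum.inl ((0, ()), {()}) : Trip Unit Unit) ∈ trips R 1 (fun _ => ({()} : Finset Unit)) id {()} :=
      inl_mem_trips.2 (mem_tripJ.2 ⟨zero_lt_one, singleton_mem_polys hu, mem_pts.2 ⟨hu, hu⟩⟩)
    have h2 : (Sum.inr {()} : Trip Unit Unit) ∈ trips R 1 (fun _ => ({()} : Finset Unit)) id {()} :=
      inr_mem_trips.2 (singleton_mem_polys hu)
    have hc1 : ({Sum.inl ((0, ()), {()})} : Finset (Trip Unit Unit)) ∈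
        covers R 1 (fun _ => ({()} : Finset Unit)) id {()} :=
      mem_covers.2 ⟨singleton_subset_iff.2 h1, by rw [singleton_biUnion, Trip.poly_inl]⟩
    have hc2 : ({Sum.inr {()}} : Finset (Trip Unit Unit)) ∈ covers R 1 (fun _ => ({()} : Finset Unit)) id {()} :=
      mem_covers.2 ⟨singleton_subset_iff.2 h2, by rw [singleton_biUnion, Trip.poly_inr]⟩
    have hc3 : ({Sum.inl ((0, ()), {()}), Sum.inr {()}} : Finset (Trip Unit Unit)) ∈
        covers R 1 (fun _ => ({()} : Finset Unit)) id {()} :=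
      mem_covers.2 ⟨insert_subset_iff.2 ⟨h1, singleton_subset_iff.2 h2⟩, by
        rw [biUnion_insert, singleton_biUnion, Trip.poly_inl, Trip.poly_inr, union_idempotent]⟩
    have hne12 : ({Sum.inl ((0, ()), {()})} : Finset (Trip Unit Unit)) ≠ {Sum.inr {()}} :=
      fun h => Sum.inl_ne_inr (singleton_injective h)
    have hne13 : ({Sum.inl ((0, ()), {()})} : Finset (Trip Unit Unit)) ≠ {Sum.inl ((0, ()), {()}), Sum.inr {()}} := by
      intro h
      have : (Sum.inr {()} : Trip Unit Unit) ∈ ({Sum.inl ((0, ()), {()})} : Finset (Trip Unit Unit)) := by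
        rw [h]; exact mem_insert_of_mem (mem_singleton_self _)
      exact Sum.inr_ne_inl (mem_singleton.1 this)
    have hne23 : ({Sum.inr {()}} : Finset (Trip Unit Unit)) ≠ {Sum.inl ((0, ()), {()}), Sum.inr {()}} := by
      intro h
      have : (Sum.inl ((0, ()), {()}) : Trip Unit Unit) ∈ ({Sum.inr {()}} : Finset (Trip Unit Unit)) := by
        rw [h]; exact mem_insert_self _ _
      exact Sum.inl_ne_inr (mem_singleton.1 this)
    have hsub : ({{Sum.inl ((0, ()), {()})}, {Sum.inr {()}}, {Sum.inl ((0, ()), {()}), Sum.inr {()}}} :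
        Finset (Finset (Trip Unit Unit))) ⊆ covers R 1 (fun _ => ({()} : Finset Unit)) id {()} :=
      insert_subset_iff.2 ⟨hc1, insert_subset_iff.2 ⟨hc2, singleton_subset_iff.2 hc3⟩⟩
    have hlow : ∑ S ∈ ({{Sum.inl ((0, ()), {()})}, {Sum.inr {()}}, {Sum.inl ((0, ()), {()}), Sum.inr {()}}} :
        Finset (Finset (Trip Unit Unit))), ∏ t ∈ S, act (ctrW s κ) t ≤
        ∑ S ∈ covers R 1 (fun _ => ({()} : Finset Unit)) id {()}, ∏ t ∈ S, act (ctrW s κ) t :=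
      sum_le_sum_of_subset_of_nonneg hsub fun S _ _ => prod_nonneg fun t _ => ha0 t
    rw [sum_insert (by simp only [mem_insert, mem_singleton, not_or]; exact ⟨hne12, hne13⟩), sum_pair hne23,
      prod_singleton, prod_singleton, prod_pair Sum.inl_ne_inr, act_ctrW_inl (by linarith),
      act_ctrW_inr (by linarith)] at hlow
    have habs := le_abs_self (mayerSum R 1 (fun _ => ({()} : Finset Unit)) id (act (ctrW s κ)) {()})
    have hkey := exp_mul_lt_of_small hs0 hs1 hκ0 ((mul_le_of_le_one_right hκ0.le hs1).trans_lt hκ1)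
    unfold mayerSum at habs hX
    linarith

end Counterexample

/-! ## §7 (5.11.3) repaired, in the printed letters -/

section Repaired

variable {R : V → V → Prop} {k : ℕ} {lf : ℕ → Finset Pt} {home : Pt → V}

open BIJ88Sect5StatementsPart2 (Ineq5111 Ineq5113)

/-- From activity bounds to `Ineq5113` with modified constants: if `(θ + θ/κ + 4(Δ+1)²(θ/κ)²) ε_j ≤ e_j^{1−α} e^{−c′r(e_k)}`
for `j < k` and `κ e^{κ + 4(Δ+1)²θ/κ} ≤ K′^{n̄+1}`, the covering sum obeys (5.11.3) with the constants `c′, K′`.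
[cite: BalabanImbrieJaffe1988, (5.11.3) p.299] -/
theorem ineq5113_of_activity_bounds (hR : ∀ x y, R x y → R y x) {nbr : V → Finset V} {Δ : ℕ}
    (hΔ : ∀ x, (nbr x).card ≤ Δ) (hnbr : ∀ x y, R x y → y ∈ nbr x) {ε : ℕ → ℝ} {θ κ : ℝ} (hε : ∀ j, 0 ≤ ε j)
    (hθ : 0 ≤ θ) (hκ0 : 0 < κ) (hκ1 : κ ≤ 1) (hsmall : 2 * ((Δ : ℝ) + 1) ^ 2 * θ ≤ κ)
    {e : ℕ → ℝ} {α c' rk K' : ℝ} {nbar : ℕ}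
    (hc' : ∀ j, j < k → (θ + θ / κ + 4 * ((Δ : ℝ) + 1) ^ 2 * (θ / κ) ^ 2) * ε j ≤ e j ^ (1 - α) * Real.exp (-(c' * rk)))
    (hK' : κ * Real.exp (κ + 4 * ((Δ : ℝ) + 1) ^ 2 * (θ / κ)) ≤ K' ^ (nbar + 1))
    {a : Trip V Pt → ℝ} (ha : ∀ X, ∀ t ∈ trips R k lf home X, |a t| ≤ bnd ε θ κ t) :
    Ineq5113 (cubeSys V) k (mayerSum R k lf home a) e (lfVol lf home) α c' rk K' nbar := by
  intro X
  have hmain := abs_mayerSum_le hR hΔ hnbr hε hθ hκ0 hκ1 hsmall X (ha X)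
  have hq0 : 0 ≤ κ * Real.exp (κ + 4 * ((Δ : ℝ) + 1) ^ 2 * (θ / κ)) := mul_nonneg hκ0.le (Real.exp_pos _).le
  have h1 : (θ + θ / κ + 4 * ((Δ : ℝ) + 1) ^ 2 * (θ / κ) ^ 2) * lfWeight k lf home ε X ≤
      ∑ j ∈ range k, e j ^ (1 - α) * Real.exp (-(c' * rk)) * (lfVol lf home j X : ℝ) := by
    rw [lfWeight, mul_sum]
    refine sum_le_sum fun j hj => ?_
    rw [← mul_assoc]
    exact mul_le_mul_of_nonneg_right (hc' j (mem_range.1 hj)) (Nat.cast_nonneg _)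
  calc |mayerSum R k lf home a X| ≤ _ := hmain
    _ ≤ Real.exp (∑ j ∈ range k, e j ^ (1 - α) * Real.exp (-(c' * rk)) * (lfVol lf home j X : ℝ)) *
          (K' ^ (nbar + 1)) ^ X.card :=
        mul_le_mul (Real.exp_le_exp.2 h1) (pow_le_pow_left₀ hq0 hK' _) (pow_nonneg hq0 _) (Real.exp_pos _).le
    _ = _ := by rw [← pow_mul]; rfl

/-- **(5.11.3) repaired, printed letters.** With `θ := e^{−cr(e_k)}`, `κ := [e^β(L^kε/ε₀)]^{n̄+1}` (`0 < e^β(L^kε/ε₀) ≤ 1`),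
`e_j ≥ 0`, activities obeying (5.11.1) (`|a(j, x_j, Y)| ≤ e_j^{1−α} θ^{|Y|}` for `j < k`, `|a(k, x_k, Y)| ≤ κ θ^{|Y|^−}`; p. 299:
*"e^{−W} − 1 satisfies the same bound as W"*) and the smallness `2(Δ+1)²θ ≤ κ`: (5.11.3) holds for every `c′`, `K′` with
`θ + θ/κ + 4(Δ+1)²(θ/κ)² ≤ e^{−c′r(e_k)}` and `κ e^{κ + 4(Δ+1)²θ/κ} ≤ K′^{n̄+1}` — the print's `c′` and the worst-case constant
made explicit. [cite: BalabanImbrieJaffe1988, (5.11.3) p.299] -/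
theorem ineq5113_repaired (hR : ∀ x y, R x y → R y x) {nbr : V → Finset V} {Δ : ℕ} (hΔ : ∀ x, (nbr x).card ≤ Δ)
    (hnbr : ∀ x y, R x y → y ∈ nbr x) {e : ℕ → ℝ} {α c rk K c' K' θ κ : ℝ} {nbar : ℕ}
    (hθ : θ = Real.exp (-(c * rk))) (hκ : κ = K ^ (nbar + 1)) (he : ∀ j, 0 ≤ e j) (hK0 : 0 < K) (hK1 : K ≤ 1)
    (hsmall : 2 * ((Δ : ℝ) + 1) ^ 2 * θ ≤ κ)
    (hc' : θ + θ / κ + 4 * ((Δ : ℝ) + 1) ^ 2 * (θ / κ) ^ 2 ≤ Real.exp (-(c' * rk)))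
    (hK' : κ * Real.exp (κ + 4 * ((Δ : ℝ) + 1) ^ 2 * (θ / κ)) ≤ K' ^ (nbar + 1))
    {a : Trip V Pt → ℝ} (ha : ∀ X, ∀ t ∈ trips R k lf home X, |a t| ≤ bnd (fun j => e j ^ (1 - α)) θ κ t) :
    Ineq5113 (cubeSys V) k (mayerSum R k lf home a) e (lfVol lf home) α c' rk K' nbar := by
  have hθ0 : 0 ≤ θ := by rw [hθ]; exact (Real.exp_pos _).le
  have hκ0 : 0 < κ := by rw [hκ]; exact pow_pos hK0 _
  have hκ1 : κ ≤ 1 := by rw [hκ]; exact pow_le_one₀ hK0.le hK1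
  refine ineq5113_of_activity_bounds hR hΔ hnbr (fun j => Real.rpow_nonneg (he j) _) hθ0 hκ0 hκ1 hsmall
    (fun j _ => ?_) hK' ha
  rw [mul_comm]
  exact mul_le_mul_of_nonneg_left hc' (Real.rpow_nonneg (he j) _)

/-- The interaction of (5.11.2) on triplets: `W(j, x_j, Y) = W_{4,j}^{(k)}(x_j, Y)` for `j < k` and `W(k, x_k, Y) = W_{4,k}^{(k)}(x_k, Y)`.
[cite: BalabanImbrieJaffe1988, (5.11.2) p.299] -/
def trW (W₄ⱼ : ℕ → Pt → Finset V → ℝ) (W₄ₖ : Finset V → ℝ) : Trip V Pt → ℝ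
  | Sum.inl t => W₄ⱼ t.1.1 t.1.2 t.2
  | Sum.inr Y => W₄ₖ Y

omit [DecidableEq V] [DecidableEq Pt] in
/-- Unfolding `trW` on a `j < k` triplet. [cite: BalabanImbrieJaffe1988, (5.11.2) p.299] -/
@[simp] theorem trW_inl (W₄ⱼ : ℕ → Pt → Finset V → ℝ) (W₄ₖ : Finset V → ℝ) (t : (ℕ × Pt) × Finset V) :
    trW W₄ⱼ W₄ₖ (Sum.inl t) = W₄ⱼ t.1.1 t.1.2 t.2 := rfl

omit [DecidableEq V] [DecidableEq Pt] in
/-- Unfolding `trW` on a `j = k` triplet. [cite: BalabanImbrieJaffe1988, (5.11.2) p.299] -/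
@[simp] theorem trW_inr (W₄ⱼ : ℕ → Pt → Finset V → ℝ) (W₄ₖ : Finset V → ℝ) (Y : Finset V) :
    trW W₄ⱼ W₄ₖ (Sum.inr Y) = W₄ₖ Y := rfl

omit [DecidableEq V] [DecidableEq Pt] in
/-- `|e^{−w} − 1| ≤ 2|w|` for `|w| ≤ 1`: the activities obey the bounds of the interaction up to a factor `2` (p. 299:
*"satisfies the same bound"*). [folklore] -/
private theorem abs_act_le {W : Trip V Pt → ℝ} {t : Trip V Pt} {b : ℝ} (hb : |W t| ≤ b) (hb1 : b ≤ 1) :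
    |act W t| ≤ 2 * b := by
  unfold act
  have h := Real.abs_exp_sub_one_le (x := -W t) (by rw [abs_neg]; exact hb.trans hb1)
  rw [abs_neg] at h
  linarith

/-- **(5.11.3) from (5.11.1), honest constants.** If `W_{4,j}^{(k)}`, `W_{4,k}^{(k)}` obey (5.11.1) (`Ineq5111` for polymers =
finite unions of cubes), `0 ≤ e_j ≤ 1`, `α ≤ 1`, `cr(e_k) ≥ 0`, `0 < e^β(L^kε/ε₀)`, `κ := [e^β(L^kε/ε₀)]^{n̄+1} ≤ 1/2`, and
`(Δ+1)²θ ≤ κ` (`θ := e^{−cr(e_k)}`), then the activities `e^{−W} − 1` of (5.11.2) obey (5.11.1) with doubled constants and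
(5.11.3) holds for every `c′, K′` with `2(θ + θ/(2κ) + 4(Δ+1)²(θ/(2κ))²) ≤ e^{−c′r(e_k)}` and
`2κ e^{2κ + 4(Δ+1)²θ/(2κ)} ≤ K′^{n̄+1}`. [cite: BalabanImbrieJaffe1988, (5.11.3) p.299] -/
theorem ineq5113_of_ineq5111 (hR : ∀ x y, R x y → R y x) {nbr : V → Finset V} {Δ : ℕ} (hΔ : ∀ x, (nbr x).card ≤ Δ)
    (hnbr : ∀ x y, R x y → y ∈ nbr x) {e : ℕ → ℝ} {α c rk K c' K' θ κ : ℝ} {nbar : ℕ}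
    (hθ : θ = Real.exp (-(c * rk))) (hκ : κ = K ^ (nbar + 1)) (he0 : ∀ j, 0 ≤ e j) (he1 : ∀ j, e j ≤ 1) (hα : α ≤ 1)
    (hc : 0 ≤ c * rk) (hK0 : 0 < K) (hκh : κ ≤ 1 / 2) (hsmall : ((Δ : ℝ) + 1) ^ 2 * θ ≤ κ)
    (hc' : 2 * (θ + θ / (2 * κ) + 4 * ((Δ : ℝ) + 1) ^ 2 * (θ / (2 * κ)) ^ 2) ≤ Real.exp (-(c' * rk)))
    (hK' : 2 * κ * Real.exp (2 * κ + 4 * ((Δ : ℝ) + 1) ^ 2 * (θ / (2 * κ))) ≤ K' ^ (nbar + 1))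
    {W₄ⱼ : ℕ → Pt → Finset V → ℝ} {W₄ₖ : Finset V → ℝ} (h : Ineq5111 (cubeSys V) Pt k W₄ⱼ W₄ₖ e α c rk K nbar) :
    Ineq5113 (cubeSys V) k (mayerSum R k lf home (act (trW W₄ⱼ W₄ₖ))) e (lfVol lf home) α c' rk K' nbar := by
  have hθ0 : 0 < θ := by rw [hθ]; exact Real.exp_pos _
  have hθ1 : θ ≤ 1 := by rw [hθ]; exact Real.exp_le_one_iff.2 (by linarith)
  have hκ0 : 0 < κ := by rw [hκ]; exact pow_pos hK0 _
  have hε0 : ∀ j, 0 ≤ e j ^ (1 - α) := fun j => Real.rpow_nonneg (he0 j) _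
  have hε1 : ∀ j, e j ^ (1 - α) ≤ 1 := fun j => Real.rpow_le_one (he0 j) (he1 j) (by linarith)
  have hθpow : ∀ n : ℕ, Real.exp (-(c * rk) * n) = θ ^ n := by
    intro n
    rw [hθ, ← Real.exp_nat_mul]
    congr 1
    ring
  -- the activities obey (5.11.1) with doubled constants
  have ha : ∀ X, ∀ t ∈ trips R k lf home X,
      |act (trW W₄ⱼ W₄ₖ) t| ≤ bnd (fun j => 2 * e j ^ (1 - α)) θ (2 * κ) t := by
    intro X t ht
    rcases t with t | Y
    · have ht' := mem_tripJ.1 (inl_mem_trips.1 ht)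
      have hb : |trW W₄ⱼ W₄ₖ (Sum.inl t)| ≤ e t.1.1 ^ (1 - α) * θ ^ t.2.card := by
        have := h.1 t.1.1 ht'.1 t.1.2 t.2
        rw [cubeSys_card, hθpow] at this
        rwa [trW_inl]
      have hb1 : e t.1.1 ^ (1 - α) * θ ^ t.2.card ≤ 1 :=
        mul_le_one₀ (hε1 _) (pow_nonneg hθ0.le _) (pow_le_one₀ hθ0.le hθ1)
      rw [bnd_inl]
      calc |act (trW W₄ⱼ W₄ₖ) (Sum.inl t)| ≤ 2 * (e t.1.1 ^ (1 - α) * θ ^ t.2.card) := abs_act_le hb hb1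
        _ = 2 * e t.1.1 ^ (1 - α) * θ ^ t.2.card := by ring
    · have hb : |trW W₄ⱼ W₄ₖ (Sum.inr Y)| ≤ κ * θ ^ (Y.card - 1) := by
        have := h.2 Y
        rw [cubeSys_cardMinus, hθpow, ← hκ] at this
        rwa [trW_inr]
      have hb1 : κ * θ ^ (Y.card - 1) ≤ 1 :=
        (mul_le_of_le_one_right hκ0.le (pow_le_one₀ hθ0.le hθ1)).trans (by linarith)
      rw [bnd_inr]
      calc |act (trW W₄ⱼ W₄ₖ) (Sum.inr Y)| ≤ 2 * (κ * θ ^ (Y.card - 1)) := abs_act_le hb hb1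
        _ = 2 * κ * θ ^ (Y.card - 1) := by ring
  refine ineq5113_of_activity_bounds hR hΔ hnbr (fun j => mul_nonneg zero_le_two (hε0 j)) hθ0.le (by linarith)
    (by linarith) (by linarith) (fun j _ => ?_) hK' ha
  calc (θ + θ / (2 * κ) + 4 * ((Δ : ℝ) + 1) ^ 2 * (θ / (2 * κ)) ^ 2) * (2 * e j ^ (1 - α))
      = e j ^ (1 - α) * (2 * (θ + θ / (2 * κ) + 4 * ((Δ : ℝ) + 1) ^ 2 * (θ / (2 * κ)) ^ 2)) := by ring
    _ ≤ e j ^ (1 - α) * Real.exp (-(c' * rk)) := mul_le_mul_of_nonneg_left hc' (hε0 j)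

end Repaired

end Literature.MathematicalPhysics.QuantumFieldTheory.BalabanImbrieJaffe1984to88.BIJ88Ineq5113Covering

end
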